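/-
Copyright: statement-level skeleton of a published paper (lit-balaban cell, Phase-2 proof seat p39 gen 32). No proof claims
beyond what the kernel checks below.
-/
import Literature.MathematicalPhysics.QuantumFieldTheory.Balaban1983to89.B3ChargeInsertionsHigher
import Literature.MathematicalPhysics.QuantumFieldTheory.Balaban1983to89.B3Eq124VacuumChargeWick
import Literature.MathematicalPhysics.QuantumFieldTheory.Balaban1983to89.B3WTWick

/-!
# Bałaban, *(Higgs)₂,₃ quantum fields in a finite volume. III*, CMP 88 (1983) [Balaban1983Higgs3], p. 417: THE INDEX `(4,0)` OF
# THE VACUUM-ENERGY COUNTERTERM (1.24) — `∂⁴/∂e⁴ log∫dA∫dφ e^{−S^ε(A,φ)}∣_{e=λ=0}` with print's mass counterterm inserted, IN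
# CUMULANT FORM with the vector field integrated out: `⟨P₄⟩₀ − 3⟨P₂⟩₀²`; the fourth moments of the free vector field; the
# moments-to-cumulants calculus for the orders 2, 4, 6

statement-level skeleton of published theorems with citation tags; proofs where landed; nothing here is a claim about the
Yang–Mills mass gap.

[cite: Balaban1983Higgs3, (1.24) p.417 (PDF 7) and the first paragraph of p.418 (PDF 8); (1.19)–(1.22) p.416 (PDF 6); (1.23) p.417;
(1.8), (1.10) p.413 (PDF 3); (2.26) p.431 (PDF 21)] [cite: GlimmJaffeQP1987, §8.5, (9.1.3)].  Unit `lit-balaban-p39-g32` (Phase-2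
proof seat p39, gen 32), free-target protocol G.5-34(d), ZERO head weight: OPTIONAL LOCATED MEMBER of row **B3.Eq1.24** (and of
B3.Eq1.19-1.22 for the vector-field moments of §1) of `HOME/lit-balaban-r15/ROWS-B3.md` (owner r15; heads `proved`, decls of record
not restated); TAKING `HOME/STATUS.md` 2026-08-24 (BRICK 21 of this seat's series) = layers 4–5 of the successor option (F) of
`HOME/lit-balaban-p39/DESIGN-weight6-next.md` — the row owner's stated preference (r15 g20, 2026-08-24T18:22:10Z) for the open
indices `(4,0)`, `(4,1)`, `(6,0)` of print's range `2 ≦ α+2β ≦ 6` *"in structural/cumulant form"*; this file does `(4,0)` (and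
carries `(2,0)` and the raw `(6,0)` alongside).  IMPORTED BY NAME, nothing of record redeclared: BRICK 20 `B3ChargeInsertionsHigher`
(this seat, gen 31: the insertions `D_k`, `hopK`, the Faà di Bruno polynomials `Dpoly`/`delta`, the mass-curve family `MassCurve.fM` /
`MassCurve.DkM` and §8 `MassCurve.hasDerivAt_integral_DkM_J_mul` / `integrable_DkM_J_mul` — the derivative family of `Z^{ct}` of all
orders on an open set of charges), BRICK 13 `B3Eq124VacuumChargeWick` (`Z_curve_neg_charge`: the partition function with an even
counterterm is even in the charge; `integral_J_zero_eq`: `Z(0) = Z_A·Z₀`), BRICK 7 `B3Eq122ChargeWick` (the joint weight `J`, `WA`,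
`toVec`, `J_zero`, `integral_WA_toVec_toVec`, `integral_J_pos`, `ZA_pos`), this seat's `B3WTWick.moment4` (Wick's theorem for four
fields) and the typer's `B3WickVertexCalculus.ExpGrowth` toolbox.  BRICK 13's four private parity lemmas (odd derivatives of an even
function vanish at `0`) and its private `dm2Of123_at_lam_zero` are re-derived privately ([folklore] / r15's definition unfolded).

PDF held: `paper:balaban1983-higgs-2-3-quantum-fields-finite-volume` (journal page = PDF page + 410); pp. 413, 416–418, 431 read for
BRICKS 1/7/12–20 on the ×2 renders `run/shared/lean/pub/pub-balaban/b2b-balaban-ref1/pages/1983-cmp88-higgs23-III/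
1983-cmp88-higgs23-III-p003-x2.png`, `…-p006-x2.png`, `…-p007-x2.png`, `…-p008-x2.png`, `…-p021-x2.png`; p. 417 re-read AS AN IMAGE
for this file (2026-08-24T21:12Z; the displayed terms of (1.23) listed below); no new quotation is introduced here.  The sentences served are p. 417 (1.24) *"E₁ = Σ_{1≤α+β≤n̄}(1/(α!β!))e^αλ^β(∂^{α+β}/∂e^α∂λ^β log∫dA∫dφ
e^{−S^ε(A,φ)})∣_{e=λ=0}"* and p. 418 *"Terms of this expansion are described by connected graphs without external legs (vacuum
graphs). To renormalize the theory it is sufficient to take the terms in the expansion (1.24) restricted by the condition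
2 ≤ α + 2β ≤ 6"* (quoted in BRICKS 13/17), with the mass counterterm `δm² = Σ_{2≦α+2β≦4}e^αλ^βδm²_{(α,β)}` of (1.23) INSIDE `S^ε`
(p. 418: *"In S^ε, defined in (I.1.11), we of course have dropped the term E"* — BRICK 13's reading, kept).

WHAT WAS IN THE TREE BEFORE (row B3.Eq1.24, r15's bookkeeping after BRICKS 12–18): (1.24) typed with body (`B3Sect1TwoPoint.E1of124R`);
DERIVED from the measure: `(2,0)` in closed form (BRICK 13), `(0,1)`, `(0,2)` (BRICK 12 §10), `(0,3)` (BRICK 15), `(2,1)` (BRICK 16/18),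
`(2,2)` in cumulant form (BRICK 17), every `(odd, β) = 0` (BRICK 13 §10); the charge derivatives of ALL orders of the measure and
of `Z^{ct}` along a mass curve (BRICK 20).  NOT derived: `(4,0)`, `(4,1)`, `(6,0)`.  THIS FILE: `(4,0)`.

THE MATHEMATICS (ours; Glimm–Jaffe §8.5 / (9.1.3) is the frame — derivatives of `log∫e^{−S(s)}` are cumulants of insertions).
Write `Z^{ct}(e) = ∫dA dφ J_e(m² + ct(e))` for BRICK 7's joint weight at scalar mass `m² + ct(e)` (`ct` = print's `δm²(e, λ=0) =
δm²_{(2,0)}e² + δm²_{(4,0)}e⁴`, an EVEN curve), and `Z_k := (Z^{ct})⁽ᵏ⁾(0) = ∫dA dφ D^M_k(0;A,φ)J_0` (BRICK 20 §8, `D^M_k` = the Faà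
di Bruno polynomial `D_k` in the symbols `f_i = h_i − ½ct⁽ⁱ⁾Σ_xη^d∣φ(x)∣²`).  (§4) For ANY `Z` positive and even with a derivative
family of all orders on an open set `S ∋ 0`: `Z` is `C^∞` on `S` (`contDiffOn_of_family`), so is `L = log Z`, and BRICK 20's
abstract Faà di Bruno — here in LOCAL form on `S` (`iteratedDeriv_eq_Dpoly_family_of_isOpen`) — applied to `Z = e^{L}` with the
symbols `ℓ_i = L⁽ⁱ⁾` gives `Z⁽ᵏ⁾(0) = D_k(ℓ)(0)·Z(0)`; the odd `ℓ_i(0)` vanish (`L` even), whence (`eval_Dpoly_two/four/six`: `D₂ = ℓ₂ +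
ℓ₁²`, `D₄ = ℓ₄ + 4ℓ₁ℓ₃ + 3ℓ₂² + 6ℓ₁²ℓ₂ + ℓ₁⁴`, `D₆` = the complete Bell polynomial `B₆`) **`ℓ₂ = Z₂/Z₀`, `ℓ₄ = Z₄/Z₀ − 3(Z₂/Z₀)²`,
`ℓ₆ = Z₆/Z₀ − 15Z₂Z₄/Z₀² + 30(Z₂/Z₀)³`** (`iteratedDeriv_log_of_even`) — moments to cumulants at a symmetric point.  (§5)
`iteratedDeriv_logZ_massCurve_raw`: these ARE the indices `(2,0)`, `(4,0)`, `(6,0)` of (1.24) (times `α!`), the hypotheses being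
BRICK 20 §8's (an open `S ∋ 0` with `m² + ct ≥ m²/2`, `∣ct⁽ⁱ⁾∣ ≤ B_c`) plus `ct` even (BRICK 13 `Z_curve_neg_charge` ⇒ `Z^{ct}` even).
(§1–§3) AT `e = 0` THE VECTOR FIELD INTEGRATES OUT: `J_0 = W_A(A)·W₀(φ)` (BRICK 7 `J_zero`), `h_i(0;A,φ) = Σ_bκ_i(φ;b)A_bⁱ` with
**`κ_i(φ;b) = η^dc²ηⁱ⟪φ(b₋),qⁱφ(b₊)⟫`** (`kap`; print's vertices (1.8)ₙ,₀/(1.10)ₙ,₀ at `n = i` per unit `A_bⁱ`), so `D^M_4(0;A,φ) = f₄ +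
4f₁f₃ + 3f₂² + 6f₁²f₂ + f₁⁴` (`DkM_four`; `f₁ = h₁`, `f₃ = h₃` as `ct′(0) = ct‴(0) = 0`, `f₂ = h₂ − ½ct″(0)Q`, `f₄ = h₄ − ½ct⁗(0)Q`,
`Q = Σ_xη^d∣φ(x)∣²`) is a polynomial of degree four in the Gaussian bond variables `A_b` with covariance **`cv(b,b′) =
δ_{μ_bμ_{b′}}C^ε(b₋,b′₋)`** (`cv`; BRICK 7), whose FOURTH MOMENTS are the three pairings (`integral_WA_toVec_four` ← `B3WTWick.moment4` at
`N := d`, legs `⟪A(b₋),e_{μ_b}⟫ = A_b`); integrating each shape (`wai_sum_pow_four`: `⟨Σκ_bA_b⁴⟩ = 3Σκ_bcv(b,b)²`;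
`wai_sum_mul_sum_pow_three`: `3Σκκ′cv(b,b′)cv(b′,b′)`; `wai_sum_sq_mul_sum_sq`: `Σκκ′[cv(b,b)cv(b′,b′) + 2cv(b,b′)²]`;
`wai_sum_mul_sum_mul_sum_sq`: `Σκκ′κ″[cv(b,b′)cv(b″,b″) + 2cv(b,b″)cv(b′,b″)]`; `wai_sum_pow_four'`: four cubic vertices, three
pairings; the bookkeeping predicate `WAI g v` ⇔ `∫W_Ag = Z_Av`, closed under linear combinations) gives **`∫dA W_A·D^M_4(0;A,φ) =
Z_A·P₄(φ)`** (`wai_DkM_four`) and `∫dA W_A·D^M_2(0;A,φ) = Z_A·P₂(φ)` (`wai_DkM_two`) with the EXPLICIT polynomials `P2`, `P4` in the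
scalar field (defs with bodies, §2), and by Fubini (`integral_DkM_J_zero_eq`) `Z_k = Z_A·∫dφ W₀P_k` (`k = 2, 4`), `Z₀ = Z_A·∫W₀`.  Hence
THE HEADLINE **`iteratedDeriv_four_logZ_massCurve`: `∂⁴/∂e⁴∣₀ log Z^{ct} = ⟨P₄⟩₀ − 3⟨P₂⟩₀²`** (and `∂²/∂e²∣₀ log Z^{ct} = ⟨P₂⟩₀`),
`⟨·⟩₀ = ∫W₀(·)/∫W₀` the free scalar expectation at mass `m²`; **`iteratedDeriv_four_logZ_poly`**: the same for print's curve
`δ₂e² + δ₄e⁴` with NO hypothesis beyond `η^d, m², μ₀² > 0` (the ball and the bounds are constructed: `polyCts`, `hasDerivAt_polyCts`,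
`abs_polyCts_le`, `exists_ball_polyCts`), the counterterm vertices entering as `ct″(0) = 2δm²_{(2,0)}` (in `P₂` and `P₄`) and
`ct⁗(0) = 24δm²_{(4,0)}` (in `P₄`, linearly, through the bubble `−½ct⁗(0)⟨Q⟩₀`); **`iteratedDeriv_four_logZ_dm2Of123`**: the same with
r15's typed series `B3Sect1TwoPoint.dm2Of123 e 0 ε^d Σ^ε` (any coefficients, `δm²_{(3,0)} = 0` as (1.23) has it).

WHICH COEFFICIENT OF (1.24) THIS IS, AND WHAT IS LEFT SYMBOLIC (owner r15's ask, 2026-08-24T21:00:40Z).  ORDER OF DIFFERENTIATION: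
pure `e`, FOUR times, two-sided, at `e = 0`, with `λ = 0` throughout — no `λ`-derivative is involved, so the order-of-differentiation
question of BRICKS 16–18 does not arise; the differentiation runs ALONG THE MASS CURVE `m² + δm²(e, λ=0)`, i.e. the function
differentiated is `e ↦ log∫dA dφ J_e(m² + ct(e))` with `ct(e) = δm²(e,0)` INSIDE the measure (BRICK 13's reading of p. 418 *"In S^ε
… we of course have dropped the term E"*: only `E` is dropped, `δm²` stays).  The `(α,β) = (4,0)` term of r01's/r15's `E1of124R` sum
is `(e⁴/4!)` times this derivative.  WHICH LETTERS OF (1.23) ENTER: at `λ = 0` the series (1.23) is `ct(e) = δm²_{(2,0)}e² +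
δm²_{(3,0)}e³ + δm²_{(4,0)}e⁴` (the `β ≥ 1` letters `δm²_{(0,1)}, δm²_{(1,1)}, δm²_{(2,1)}, δm²_{(0,2)}` carry `λ^β = 0`); the index
set `2 ≦ α+2β ≦ 4` of (1.23) formally contains `(3,0)`, but print's displayed expansion of `δm²` on p. 417 (re-read as an image for this
file, `…-p007-x2.png`) carries even powers of `e` only (`e²dC^ε(0)q²`, `(2·3/4!)de⁴ε²(C^ε(0))²q⁴`, `−e²Σ…`, `+2de⁴Σ…`, the `λ`, `λ²`
and `e²δm₁²` terms, then *"+ …"*), BRICK 10 derived `Σ^ε_{(3,0)} = 0` on the two-point side, and here `δm²_{(3,0)} = 0` is the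
HYPOTHESIS `h30` of the `dm2Of123` form (built into `polyCts`); with it the curve is EVEN, which is what makes every odd `e`-order of
`log Z^{ct}` vanish (BRICK 13 §4: `A ↦ −A`) and what §4 here uses (`ℓ₁ = ℓ₃ = ℓ₅ = 0`).  The insertions see the curve only through its derivatives at `0`: `ct′(0) = ct‴(0) = 0`, **`ct″(0) = 2δm²_{(2,0)}`** (enters `P₂`
as the bubble `−δm²_{(2,0)}·Σ_xη^d∣φ(x)∣²` and `P₄` through `f₂ = h₂ − δm²_{(2,0)}Q` in `3f₂²`, `6f₁²f₂`), **`ct⁗(0) = 24δm²_{(4,0)}`**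
(enters `P₄` ONLY, linearly, as the bubble `−12δm²_{(4,0)}·Σ_xη^d∣φ(x)∣²` from `f₄ = h₄ − 12δm²_{(4,0)}Q`); no other letter of (1.23)
enters `(4,0)`.  WHAT IS LEFT SYMBOLIC: exactly the two free scalar Gaussian expectations **`⟨P₄⟩₀ = ∫dφ W₀(φ)P₄(φ)/∫dφ W₀(φ)`** and
**`⟨P₂⟩₀ = ∫dφ W₀(φ)P₂(φ)/∫dφ W₀(φ)`**, `W₀ = e^{−½⟨φ,(−Δ^η_0+m²)φ⟩}` at the mass `m²` (`ct(0) = 0`), of the explicit polynomials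
`P₄` (degree ≤ 8 in `φ`, §2 `P4`) and `P₂` (degree ≤ 4, §2 `P2`; BRICK 13 evaluated `⟨P₂⟩₀`: figure-eight + theta − bubble); the
vector-field integrals are DONE (the `cv`-coefficients of `P₂`, `P₄`).  The carrier remark of BRICK 13 («identification of READINGS»
between r01's `partitionFn` and BRICK 7's `J`) applies verbatim.

WHAT THIS FILE PROVES — definitions WITH BODIES: `cv` (vector covariance in bond components), `WAI` (the bookkeeping predicate), `kap`
(the coefficients `κ_i(φ;b)`), `P2`, `P4` (the `A`-integrated insertions), `polyCts` (the derivative family of `δ₂e² + δ₄e⁴`);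
theorems as above; no named fact, no `sorry`, standard axioms.

HONEST SCOPE.  (a) CUMULANT FORM, as the row owner allows: `⟨P₄⟩₀` and `⟨P₂⟩₀` are LEFT AS free scalar Gaussian expectations of
explicit polynomials (degree ≤ 8 in `φ`); the scalar Wick theorem that would draw print's *"connected graphs without external legs"*
of order `e⁴` (and exhibit the cancellation of the disconnected part of `⟨P₄⟩₀` against `3⟨P₂⟩₀²`) is NOT performed here (BRICK 13 did
it at order `e²`: figure-eight + theta − bubble).  (b) `(6,0)` is given in RAW form only (`Z₆/Z₀ − 15Z₂Z₄/Z₀² + 30(Z₂/Z₀)³` with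
`Z₆ = ∫D^M_6(0)e^{−S_0}`): its `A`-integration needs the eleven shapes of `D₆` (`eval_Dpoly_six`) and the sixth vector moments
(fifteen pairings) — a successor's; `(4,1)` (one `λ`-derivative within `[0,∞)` on top) is not touched.  (c) No estimate: nothing is
claimed about the size of these terms as `ε → 0` or about p. 418's *"the other terms are convergent"*.  (d) Finite torus, Feynman gauge,
any `d`, `N`, mesh, level; `λ = 0`; scalar counterterm `δm²` as printed (the bubble carries `Σ_xη^d∣φ(x)∣²`, i.e. `N·Σ_xη^dC₀(x,x)` after
Wick).  (e) The parity lemmas and `dm2Of123_at_lam_zero'` are private re-derivations (BRICK 13's are private there).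

References: [Balaban1983Higgs3] T. Bałaban, *(Higgs)₂,₃ quantum fields in a finite volume. III. Renormalization*, CMP 88 (1983)
411–445, pp. 413, 416–418, 431; [Balaban1982Higgs1] T. Bałaban, CMP 85 (1982) 603–636, (1.7), (1.11) p. 605 (`U(A) = exp(qεeA)`,
Feynman gauge) as vendored in `LatticeFieldCalculus`/`HiggsLattice`; [GlimmJaffeQP1987] J. Glimm, A. Jaffe, *Quantum Physics. A
Functional Integral Point of View*, 2nd ed. (Springer 1987), §8.5 (perturbation theory = cumulants of insertions), §9.1 (9.1.3)
(Gaussian integration by parts / Wick).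
Unit `lit-balaban-p39` gen 32 (literature-prover-lit-balaban-p39-g32-0), HOME `run/shared/lean/pub/lit-balaban/`, 2026-08-24.
-/

noncomputable section

open scoped BigOperators InnerProductSpace Topology

namespace Literature.MathematicalPhysics.QuantumFieldTheory.Balaban1983to89.B3Eq124IndexFourZero

open _root_.MeasureTheory _root_.Filter _root_.Set
open LatticeFieldCalculus B3WT223Instance B3WTPropagator B3WTCovariance B3WickVertexCalculus B3Eq122ChargeWick
  B3ChargeInsertionsHigher B3ChargeInsertionsHigher.MassCurve MvPolynomial

variable {P : Params} {j N : ℕ} (C : HiggsLattice.ChargeData N) (η w c m2 μ2 : ℝ)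

/-! ## §1 The vector-field Gaussian of (1.20) at `e = 0`: covariance `δ_{μμ′}C^ε(b₋,b′₋)` and the FOURTH MOMENTS (three pairings) -/

/-- the covariance of the bond components of the free vector field: `⟨A_bA_{b′}⟩/Z_A = δ_{μ_bμ_{b′}}·C^ε(b₋,b′₋)`,
`C^ε = (−Δ^η+μ₀²)⁻¹` (BRICK 7 `integral_WA_toVec_toVec`, Feynman gauge). [cite: Balaban1983Higgs3, (1.21) p.416] -/
def cv (w c μ2 : ℝ) (b b' : PBond P j) : ℝ := G w c μ2 b.src b'.src * (if b.dir = b'.dir then 1 else 0)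

omit C η m2 in
/-- `cv` is symmetric. [cite: Balaban1983Higgs3, (1.21) p.416] -/
theorem cv_symm (b b' : PBond P j) : cv w c μ2 b b' = cv w c μ2 b' b := by
  unfold cv
  rw [G_symm w c μ2 b.src b'.src]
  by_cases h : b.dir = b'.dir
  · rw [if_pos h, if_pos h.symm]
  · rw [if_neg h, if_neg (fun h' => h h'.symm)]

omit C η m2 in
/-- the diagonal `cv(b,b) = C^ε(b₋,b₋)`. [cite: Balaban1983Higgs3, (1.21) p.416] -/
theorem cv_self (b : PBond P j) : cv w c μ2 b b = G w c μ2 b.src b.src := by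
  simp [cv]

omit C m2 in
/-- the orthonormality of the component directions: `⟪e_{μ_b}, e_{μ_{b′}}⟫ = δ_{μ_bμ_{b′}}`. [folklore] -/
private theorem inner_basisFun_dir (b b' : PBond P j) :
    ⟪EuclideanSpace.basisFun (Fin P.d) ℝ b.dir, EuclideanSpace.basisFun (Fin P.d) ℝ b'.dir⟫_ℝ =
      if b.dir = b'.dir then 1 else 0 := by
  classical
  exact orthonormal_iff_ite.mp (EuclideanSpace.basisFun (Fin P.d) ℝ).orthonormal _ _

omit C m2 in
/-- the bond component `A ↦ A_b` is an observable of exponential-linear growth. [cite: Balaban1983Higgs3, (2.24) p.430 (admissible F: ours)] -/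
theorem expGrowth_toVec (b : PBond P j) : ExpGrowth (fun A : Cfg P j P.d => toVec A b) :=
  ExpGrowth.inner_apply b.src _

omit C m2 in
/-- **`⟨A_bA_{b′}⟩ = Z_A·cv(b,b′)`** (BRICK 7, restated with `cv`). [cite: Balaban1983Higgs3, (1.21) p.416] -/
theorem integral_WA_toVec_two (hw : 0 < w) (hμ : 0 < μ2) (b b' : PBond P j) :
    ∫ A : Cfg P j P.d, WA η w c μ2 A * (toVec A b * toVec A b') = (∫ A : Cfg P j P.d, WA η w c μ2 A) * cv w c μ2 b b' := by
  rw [integral_WA_toVec_toVec η w c μ2 hw hμ b b', cv]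

omit C m2 in
/-- **THE FOURTH MOMENTS OF THE FREE VECTOR FIELD (Wick, three pairings)**:
`⟨A_{b₁}A_{b₂}A_{b₃}A_{b₄}⟩ = Z_A·[cv(b₁,b₂)cv(b₃,b₄) + cv(b₁,b₃)cv(b₂,b₄) + cv(b₁,b₄)cv(b₂,b₃)]` — this seat's `B3WTWick.moment4`
for the Gaussian `e^{−½⟨A,(−Δ^η+μ₀²)A⟩}` at `N := d` with the legs `⟪A(b₋), e_{μ_b}⟫ = A_b`. [cite: Balaban1983Higgs3, (1.21) p.416, (2.26) p.431] -/
theorem integral_WA_toVec_four (hw : 0 < w) (hμ : 0 < μ2) (b₁ b₂ b₃ b₄ : PBond P j) :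
    ∫ A : Cfg P j P.d, WA η w c μ2 A * (toVec A b₁ * (toVec A b₂ * (toVec A b₃ * toVec A b₄))) =
      (∫ A : Cfg P j P.d, WA η w c μ2 A) *
        (cv w c μ2 b₁ b₂ * cv w c μ2 b₃ b₄ + cv w c μ2 b₁ b₃ * cv w c μ2 b₂ b₄ + cv w c μ2 b₁ b₄ * cv w c μ2 b₂ b₃) := by
  have h := B3WTWick.moment4 (Cvec P.d) η w c μ2 hw hμ b₁.src b₂.src b₃.src b₄.src
    (EuclideanSpace.basisFun (Fin P.d) ℝ b₁.dir) (EuclideanSpace.basisFun (Fin P.d) ℝ b₂.dir)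
    (EuclideanSpace.basisFun (Fin P.d) ℝ b₃.dir) (EuclideanSpace.basisFun (Fin P.d) ℝ b₄.dir)
  unfold WA toVec
  rw [h]
  simp only [inner_basisFun_dir, cv]

/-! ### the bookkeeping predicate `∫W_A·g = Z_A·v` and its closure under linear combinations -/

/-- `WAI g v`: `W_A·g` is integrable and `∫dA W_A(A)g(A) = Z_A·v` — the vector field integrated out of the observable `g` with the
value `v` per unit normalization. [cite: Balaban1983Higgs3, (1.21) p.416] -/
def WAI (η w c μ2 : ℝ) (g : Cfg P j P.d → ℝ) (v : ℝ) : Prop :=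
  Integrable (fun A : Cfg P j P.d => WA η w c μ2 A * g A) ∧
    ∫ A : Cfg P j P.d, WA η w c μ2 A * g A = (∫ A : Cfg P j P.d, WA η w c μ2 A) * v

namespace WAI

variable {η w c μ2} {g g' : Cfg P j P.d → ℝ} {v v' : ℝ}

omit C m2 in
/-- from a growth bound and the value. [cite: Balaban1983Higgs3, (1.21) p.416] -/
theorem of_expGrowth (hw : 0 < w) (hμ : 0 < μ2) (hg : ExpGrowth g)
    (h : ∫ A : Cfg P j P.d, WA η w c μ2 A * g A = (∫ A : Cfg P j P.d, WA η w c μ2 A) * v) : WAI η w c μ2 g v :=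
  ⟨ExpGrowth.integrable (Cvec P.d) η w c μ2 hw hμ hg, h⟩

omit C m2 in
/-- the value. [cite: Balaban1983Higgs3, (1.21) p.416] -/
theorem integral_eq (h : WAI η w c μ2 g v) :
    ∫ A : Cfg P j P.d, WA η w c μ2 A * g A = (∫ A : Cfg P j P.d, WA η w c μ2 A) * v := h.2

omit C m2 in
/-- integrability. [cite: Balaban1983Higgs3, (1.21) p.416] -/
theorem integrable (h : WAI η w c μ2 g v) : Integrable (fun A : Cfg P j P.d => WA η w c μ2 A * g A) := h.1

omit C m2 in
/-- change of representatives. [cite: Balaban1983Higgs3, (1.21) p.416] -/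
theorem congr (h : WAI η w c μ2 g v) (hg : ∀ A, g A = g' A) (hv : v = v') : WAI η w c μ2 g' v' := by
  have e : g = g' := funext hg
  subst e; subst hv; exact h

omit C m2 in
/-- sums (linearity of the vector-field integral). [cite: Balaban1983Higgs3, (1.21) p.416] -/
theorem add (h : WAI η w c μ2 g v) (h' : WAI η w c μ2 g' v') : WAI η w c μ2 (fun A => g A + g' A) (v + v') := by
  refine ⟨?_, ?_⟩
  · refine (h.1.add h'.1).congr (Filter.Eventually.of_forall fun A => ?_)
    simp only [Pi.add_apply]
    ring
  · have e : (fun A : Cfg P j P.d => WA η w c μ2 A * (g A + g' A)) =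
        fun A => WA η w c μ2 A * g A + WA η w c μ2 A * g' A := by funext A; ring
    rw [e, integral_add h.1 h'.1, h.2, h'.2]; ring

omit C m2 in
/-- scalar multiples. [cite: Balaban1983Higgs3, (1.21) p.416] -/
theorem const_mul (r : ℝ) (h : WAI η w c μ2 g v) : WAI η w c μ2 (fun A => r * g A) (r * v) := by
  refine ⟨?_, ?_⟩
  · refine (h.1.const_mul r).congr (Filter.Eventually.of_forall fun A => ?_)
    dsimp only
    ring
  · have e : (fun A : Cfg P j P.d => WA η w c μ2 A * (r * g A)) = fun A => r * (WA η w c μ2 A * g A) := by funext A; ring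
    rw [e, integral_const_mul, h.2]; ring

omit C m2 in
/-- differences. [cite: Balaban1983Higgs3, (1.21) p.416] -/
theorem sub (h : WAI η w c μ2 g v) (h' : WAI η w c μ2 g' v') : WAI η w c μ2 (fun A => g A - g' A) (v - v') :=
  (h.add (h'.const_mul (-1))).congr (fun A => by ring) (by ring)

omit C m2 in
/-- constants (`∫W_A·r = Z_A·r`). [cite: Balaban1983Higgs3, (1.21) p.416] -/
theorem const (η c : ℝ) (hw : 0 < w) (hμ : 0 < μ2) (r : ℝ) : WAI η w c μ2 (fun _ : Cfg P j P.d => r) r :=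
  of_expGrowth hw hμ (ExpGrowth.const r) (integral_mul_const r _)

omit C m2 in
/-- finite sums. [cite: Balaban1983Higgs3, (1.21) p.416] -/
theorem sum (η c : ℝ) {ι : Type*} (s : Finset ι) {G : ι → Cfg P j P.d → ℝ} {V : ι → ℝ} (hw : 0 < w) (hμ : 0 < μ2)
    (h : ∀ i ∈ s, WAI η w c μ2 (G i) (V i)) : WAI η w c μ2 (fun A => ∑ i ∈ s, G i A) (∑ i ∈ s, V i) := by
  classical
  induction s using Finset.induction_on with
  | empty => simpa using const (P := P) (j := j) η c hw hμ 0
  | insert a s ha ih =>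
    have h' := (h a (Finset.mem_insert_self a s)).add (ih fun i hi => h i (Finset.mem_insert_of_mem hi))
    refine h'.congr (fun A => ?_) ?_
    · rw [Finset.sum_insert ha]
    · rw [Finset.sum_insert ha]

end WAI

/-! ### the moments of the shapes occurring in `D^M_2(0)`, `D^M_4(0)`: bond sums `Σ_bκ_bA_bⁱ` and their products -/

section Shapes

variable {w μ2}
variable (hw : 0 < w) (hμ : 0 < μ2)
include hw hμ

omit C m2 in
/-- `⟨A_bA_{b′}⟩`. [cite: Balaban1983Higgs3, (1.21) p.416] -/
theorem wai_two (b b' : PBond P j) : WAI η w c μ2 (fun A => toVec A b * toVec A b') (cv w c μ2 b b') :=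
  WAI.of_expGrowth hw hμ ((expGrowth_toVec b).mul (expGrowth_toVec b')) (integral_WA_toVec_two η w c μ2 hw hμ b b')

omit C m2 in
/-- `⟨A_{b₁}A_{b₂}A_{b₃}A_{b₄}⟩`. [cite: Balaban1983Higgs3, (1.21) p.416, (2.26) p.431] -/
theorem wai_four (b₁ b₂ b₃ b₄ : PBond P j) :
    WAI η w c μ2 (fun A => toVec A b₁ * (toVec A b₂ * (toVec A b₃ * toVec A b₄)))
      (cv w c μ2 b₁ b₂ * cv w c μ2 b₃ b₄ + cv w c μ2 b₁ b₃ * cv w c μ2 b₂ b₄ + cv w c μ2 b₁ b₄ * cv w c μ2 b₂ b₃) :=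
  WAI.of_expGrowth hw hμ ((expGrowth_toVec b₁).mul ((expGrowth_toVec b₂).mul ((expGrowth_toVec b₃).mul
    (expGrowth_toVec b₄)))) (integral_WA_toVec_four η w c μ2 hw hμ b₁ b₂ b₃ b₄)

omit C m2 in
/-- `⟨Σ_bκ_bA_b²⟩/Z_A = Σ_bκ_b·cv(b,b)` (the `A`-tadpole: print's ② closed). [cite: Balaban1983Higgs3, (1.21)–(1.22) p.416] -/
theorem wai_sum_sq (κ : PBond P j → ℝ) :
    WAI η w c μ2 (fun A => ∑ b, κ b * toVec A b ^ 2) (∑ b, κ b * cv w c μ2 b b) :=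
  WAI.sum η c _ hw hμ fun b _ => ((wai_two η c hw hμ b b).const_mul (κ b)).congr (fun A => by ring) rfl

omit C m2 in
/-- `⟨(Σ_bκ_bA_b)(Σ_{b′}κ′_{b′}A_{b′})⟩/Z_A = Σ_{b,b′}κ_bκ′_{b′}cv(b,b′)` (one vector line). [cite: Balaban1983Higgs3, (1.21)–(1.22) p.416] -/
theorem wai_sum_mul_sum (κ κ' : PBond P j → ℝ) :
    WAI η w c μ2 (fun A => (∑ b, κ b * toVec A b) * (∑ b, κ' b * toVec A b)) (∑ b, ∑ b', κ b * κ' b' * cv w c μ2 b b') := by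
  have h := WAI.sum η c (Finset.univ : Finset (PBond P j)) hw hμ fun b _ =>
    WAI.sum η c (Finset.univ : Finset (PBond P j)) hw hμ fun b' _ => (wai_two η c hw hμ b b').const_mul (κ b * κ' b')
  refine h.congr (fun A => ?_) rfl
  rw [Finset.sum_mul_sum]
  exact Finset.sum_congr rfl fun b _ => Finset.sum_congr rfl fun b' _ => by ring

omit C m2 in
/-- `⟨Σ_bκ_bA_b⁴⟩/Z_A = 3Σ_bκ_b·cv(b,b)²`. [cite: Balaban1983Higgs3, (1.21) p.416, (2.26) p.431] -/
theorem wai_sum_pow_four (κ : PBond P j → ℝ) :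
    WAI η w c μ2 (fun A => ∑ b, κ b * toVec A b ^ 4) (∑ b, κ b * (3 * cv w c μ2 b b ^ 2)) :=
  WAI.sum η c _ hw hμ fun b _ => ((wai_four η c hw hμ b b b b).const_mul (κ b)).congr (fun A => by ring) (by ring)

omit C m2 in
/-- `⟨(Σ_bκ_bA_b)(Σ_{b′}κ′_{b′}A_{b′}³)⟩/Z_A = 3Σ_{b,b′}κ_bκ′_{b′}cv(b,b′)cv(b′,b′)`. [cite: Balaban1983Higgs3, (1.21) p.416, (2.26) p.431] -/
theorem wai_sum_mul_sum_pow_three (κ κ' : PBond P j → ℝ) :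
    WAI η w c μ2 (fun A => (∑ b, κ b * toVec A b) * (∑ b, κ' b * toVec A b ^ 3))
      (∑ b, ∑ b', κ b * κ' b' * (3 * (cv w c μ2 b b' * cv w c μ2 b' b'))) := by
  have h := WAI.sum η c (Finset.univ : Finset (PBond P j)) hw hμ fun b _ =>
    WAI.sum η c (Finset.univ : Finset (PBond P j)) hw hμ fun b' _ => (wai_four η c hw hμ b b' b' b').const_mul (κ b * κ' b')
  refine h.congr (fun A => ?_) (Finset.sum_congr rfl fun b _ => Finset.sum_congr rfl fun b' _ => by ring)
  rw [Finset.sum_mul_sum]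
  exact Finset.sum_congr rfl fun b _ => Finset.sum_congr rfl fun b' _ => by ring

omit C m2 in
/-- `⟨(Σ_bκ_bA_b²)(Σ_{b′}κ′_{b′}A_{b′}²)⟩/Z_A = Σ_{b,b′}κ_bκ′_{b′}[cv(b,b)cv(b′,b′) + 2cv(b,b′)²]`.
[cite: Balaban1983Higgs3, (1.21) p.416, (2.26) p.431] -/
theorem wai_sum_sq_mul_sum_sq (κ κ' : PBond P j → ℝ) :
    WAI η w c μ2 (fun A => (∑ b, κ b * toVec A b ^ 2) * (∑ b, κ' b * toVec A b ^ 2))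
      (∑ b, ∑ b', κ b * κ' b' * (cv w c μ2 b b * cv w c μ2 b' b' + 2 * cv w c μ2 b b' ^ 2)) := by
  have h := WAI.sum η c (Finset.univ : Finset (PBond P j)) hw hμ fun b _ =>
    WAI.sum η c (Finset.univ : Finset (PBond P j)) hw hμ fun b' _ => (wai_four η c hw hμ b b b' b').const_mul (κ b * κ' b')
  refine h.congr (fun A => ?_) (Finset.sum_congr rfl fun b _ => Finset.sum_congr rfl fun b' _ => by ring)
  rw [Finset.sum_mul_sum]
  exact Finset.sum_congr rfl fun b _ => Finset.sum_congr rfl fun b' _ => by ring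

omit C m2 in
/-- `⟨(Σκ A)(Σκ′A)(Σκ″A²)⟩/Z_A = Σ_{b,b′,b″}κ_bκ′_{b′}κ″_{b″}[cv(b,b′)cv(b″,b″) + 2cv(b,b″)cv(b′,b″)]`.
[cite: Balaban1983Higgs3, (1.21) p.416, (2.26) p.431] -/
theorem wai_sum_mul_sum_mul_sum_sq (κ κ' κ'' : PBond P j → ℝ) :
    WAI η w c μ2 (fun A => (∑ b, κ b * toVec A b) * (∑ b, κ' b * toVec A b) * (∑ b, κ'' b * toVec A b ^ 2))
      (∑ b, ∑ b', ∑ b'', κ b * κ' b' * κ'' b'' *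
        (cv w c μ2 b b' * cv w c μ2 b'' b'' + 2 * (cv w c μ2 b b'' * cv w c μ2 b' b''))) := by
  have h := WAI.sum η c (Finset.univ : Finset (PBond P j)) hw hμ fun b _ =>
    WAI.sum η c (Finset.univ : Finset (PBond P j)) hw hμ fun b' _ =>
      WAI.sum η c (Finset.univ : Finset (PBond P j)) hw hμ fun b'' _ =>
        (wai_four η c hw hμ b b' b'' b'').const_mul (κ b * κ' b' * κ'' b'')
  refine h.congr (fun A => ?_) (Finset.sum_congr rfl fun b _ => Finset.sum_congr rfl fun b' _ =>
    Finset.sum_congr rfl fun b'' _ => by ring)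
  rw [Finset.sum_mul_sum, Finset.sum_mul]
  refine Finset.sum_congr rfl fun b _ => ?_
  rw [Finset.sum_mul]
  refine Finset.sum_congr rfl fun b' _ => ?_
  rw [Finset.mul_sum]
  exact Finset.sum_congr rfl fun b'' _ => by ring

omit C m2 in
/-- `⟨(Σ_bκ_bA_b)⁴⟩/Z_A = Σ_{b₁,b₂,b₃,b₄}κκκκ·[cv₁₂cv₃₄ + cv₁₃cv₂₄ + cv₁₄cv₂₃]` (two vector lines through four cubic vertices).
[cite: Balaban1983Higgs3, (1.21) p.416, (2.26) p.431] -/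
theorem wai_sum_pow_four' (κ : PBond P j → ℝ) :
    WAI η w c μ2 (fun A => (∑ b, κ b * toVec A b) ^ 4)
      (∑ b₁, ∑ b₂, ∑ b₃, ∑ b₄, κ b₁ * κ b₂ * κ b₃ * κ b₄ *
        (cv w c μ2 b₁ b₂ * cv w c μ2 b₃ b₄ + cv w c μ2 b₁ b₃ * cv w c μ2 b₂ b₄ + cv w c μ2 b₁ b₄ * cv w c μ2 b₂ b₃)) := by
  have h := WAI.sum η c (Finset.univ : Finset (PBond P j)) hw hμ fun b₁ _ =>
    WAI.sum η c (Finset.univ : Finset (PBond P j)) hw hμ fun b₂ _ =>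
      WAI.sum η c (Finset.univ : Finset (PBond P j)) hw hμ fun b₃ _ =>
        WAI.sum η c (Finset.univ : Finset (PBond P j)) hw hμ fun b₄ _ =>
          (wai_four η c hw hμ b₁ b₂ b₃ b₄).const_mul (κ b₁ * κ b₂ * κ b₃ * κ b₄)
  refine h.congr (fun A => ?_) rfl
  have e4 : (∑ b, κ b * toVec A b) ^ 4 =
      ((∑ b, κ b * toVec A b) * (∑ b, κ b * toVec A b)) * ((∑ b, κ b * toVec A b) * (∑ b, κ b * toVec A b)) := by ring
  rw [e4]
  simp only [Finset.sum_mul, Finset.mul_sum]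
  exact Finset.sum_congr rfl fun _ _ => Finset.sum_congr rfl fun _ _ => Finset.sum_congr rfl fun _ _ =>
    Finset.sum_congr rfl fun _ _ => by ring

end Shapes

/-! ## §2 The insertions at zero charge along the mass curve: `h_i(0;A,φ) = Σ_bκ_i(φ;b)A_bⁱ`, `f_i(0) = h_i(0) − ½ct_i(0)Σ_xη^d∣φ(x)∣²`,
`D^M_2 = f₂ + f₁²`, `D^M_4 = f₄ + 4f₁f₃ + 3f₂² + 6f₁²f₂ + f₁⁴`, and THE VECTOR FIELD INTEGRATED OUT OF `D^M_2(0)`, `D^M_4(0)` -/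

/-- the `A`-free coefficient of `A_bⁱ` in `h_i(0;A,φ)`: `κ_i(φ;b) = η^dc²ηⁱ⟪φ(b₋),qⁱφ(b₊)⟫` — print's vertices (1.8)ₙ,₀ / (1.10)ₙ,₀
at `n = i` (`i` vector legs on the bond `b`, the two scalar legs at its ends), per unit `A_bⁱ`. [cite: Balaban1983Higgs3, (1.8), (1.10) p.413] -/
def kap (i : ℕ) (φ : Cfg P j N) (b : PBond P j) : ℝ := w * (c ^ 2 * (η ^ i * ⟪φ b.src, (C.q ^ i) (φ b.tgt)⟫_ℝ))

omit m2 μ2 in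
/-- `h_i(0;A,φ) = Σ_bκ_i(φ;b)A_bⁱ` (`U(0) = 1`). [cite: Balaban1983Higgs3, (1.8), (1.10) p.413, (1.20) p.416] -/
theorem hopK_zero (i : ℕ) (A : VecField P j ℝ) (φ : Cfg P j N) :
    hopK C η w c i 0 A φ = ∑ b, kap C η w c i φ b * A b ^ i := by
  unfold hopK kap
  refine Finset.sum_congr rfl fun b _ => ?_
  rw [Ce_U_zero, one_apply_eq_self, mul_pow]
  ring

omit m2 μ2 in
/-- `f_i(0;A,φ) = Σ_bκ_i(φ;b)A_bⁱ − ½ct_i(0)·Σ_xη^d∣φ(x)∣²`. [cite: Balaban1983Higgs3, (1.20) p.416, (1.23) p.417] -/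
theorem fM_zero (cts : ℕ → ℝ → ℝ) (i : ℕ) (A : VecField P j ℝ) (φ : Cfg P j N) :
    fM C η w c cts i 0 A φ = (∑ b, kap C η w c i φ b * A b ^ i) - 1 / 2 * cts i 0 * massForm w φ := by
  rw [fM, hopK_zero]

omit m2 μ2 in
/-- `D^M_2 = f₂ + f₁²`. [cite: Balaban1983Higgs3, (1.20) p.416] [cite: GlimmJaffeQP1987, (9.1.3)] -/
theorem DkM_two (cts : ℕ → ℝ → ℝ) (e : ℝ) (A : VecField P j ℝ) (φ : Cfg P j N) :
    DkM C η w c cts 2 e A φ = fM C η w c cts 2 e A φ + fM C η w c cts 1 e A φ ^ 2 := by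
  simp [DkM, Dpoly_succ]
  ring

omit m2 μ2 in
/-- `D^M_4 = f₄ + 4f₁f₃ + 3f₂² + 6f₁²f₂ + f₁⁴`. [cite: Balaban1983Higgs3, (1.20) p.416] [cite: GlimmJaffeQP1987, (9.1.3)] -/
theorem DkM_four (cts : ℕ → ℝ → ℝ) (e : ℝ) (A : VecField P j ℝ) (φ : Cfg P j N) :
    DkM C η w c cts 4 e A φ = fM C η w c cts 4 e A φ + 4 * (fM C η w c cts 1 e A φ * fM C η w c cts 3 e A φ)
      + 3 * fM C η w c cts 2 e A φ ^ 2 + 6 * (fM C η w c cts 1 e A φ ^ 2 * fM C η w c cts 2 e A φ)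
      + fM C η w c cts 1 e A φ ^ 4 := by
  simp [DkM, Dpoly_succ, Derivation.leibniz]
  ring

/-- **THE VECTOR FIELD INTEGRATED OUT OF `D^M_2(0)`** — the polynomial `P₂(φ) = ⟨D^M_2(0;·,φ)⟩_A/Z_A = Σ_bκ₂(φ;b)C^ε(b₋,b₋)
+ Σ_{b,b′}κ₁(φ;b)κ₁(φ;b′)cv(b,b′) − ½ct″(0)Σ_xη^d∣φ(x)∣²`: the quartic vertex with its `A`-tadpole (print's ② before the scalar loop
is closed), the two cubic vertices joined by one vector line, and the mass-counterterm vertex (BRICK 13's integrand before the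
scalar Wick theorem). [cite: Balaban1983Higgs3, (1.21)–(1.22) p.416, (1.24) p.417] -/
def P2 (ct2 : ℝ) (φ : Cfg P j N) : ℝ :=
  (∑ b, kap C η w c 2 φ b * cv w c μ2 b b) + (∑ b, ∑ b', kap C η w c 1 φ b * kap C η w c 1 φ b' * cv w c μ2 b b')
    - 1 / 2 * ct2 * massForm w φ

/-- **THE VECTOR FIELD INTEGRATED OUT OF `D^M_4(0)`** — the polynomial `P₄(φ) = ⟨D^M_4(0;·,φ)⟩_A/Z_A`, term by term from
`D^M_4 = f₄ + 4f₁f₃ + 3f₂² + 6f₁²f₂ + f₁⁴` (`f₁ = h₁`, `f₃ = h₃`, `f₂ = h₂ − ½ct″(0)Q`, `f₄ = h₄ − ½ct⁗(0)Q`, `Q = Σ_xη^d∣φ(x)∣²`) and the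
vector-Gaussian moments `⟨A_b⁴⟩ = 3cv(b,b)²`, `⟨A_bA_{b′}³⟩ = 3cv(b,b′)cv(b′,b′)`, `⟨A_b²A_{b′}²⟩ = cv(b,b)cv(b′,b′) + 2cv(b,b′)²`,
`⟨A_bA_{b′}A_{b″}²⟩ = cv(b,b′)cv(b″,b″) + 2cv(b,b″)cv(b′,b″)`, `⟨A_{b₁}A_{b₂}A_{b₃}A_{b₄}⟩` = three pairings: the vertices (1.8)ₙ,₀/(1.10)ₙ,₀,
`n ≤ 4`, of total order `e⁴` with their vector legs contracted in all ways (print's *"vacuum graphs"* of order `e⁴` before the scalar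
lines are drawn), plus the mass-counterterm vertices `δm²_{(2,0)}`, `δm²_{(4,0)}`. [cite: Balaban1983Higgs3, (1.21)–(1.22) p.416, (1.23)–(1.24) p.417] -/
def P4 (ct2 ct4 : ℝ) (φ : Cfg P j N) : ℝ :=
  (∑ b, kap C η w c 4 φ b * (3 * cv w c μ2 b b ^ 2)) - 1 / 2 * ct4 * massForm w φ
  + 4 * ∑ b, ∑ b', kap C η w c 1 φ b * kap C η w c 3 φ b' * (3 * (cv w c μ2 b b' * cv w c μ2 b' b'))
  + 3 * ∑ b, ∑ b', kap C η w c 2 φ b * kap C η w c 2 φ b' * (cv w c μ2 b b * cv w c μ2 b' b' + 2 * cv w c μ2 b b' ^ 2)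
  - 3 * ct2 * massForm w φ * ∑ b, kap C η w c 2 φ b * cv w c μ2 b b
  + 3 / 4 * ct2 ^ 2 * massForm w φ ^ 2
  + 6 * ∑ b, ∑ b', ∑ b'', kap C η w c 1 φ b * kap C η w c 1 φ b' * kap C η w c 2 φ b'' *
      (cv w c μ2 b b' * cv w c μ2 b'' b'' + 2 * (cv w c μ2 b b'' * cv w c μ2 b' b''))
  - 3 * ct2 * massForm w φ * ∑ b, ∑ b', kap C η w c 1 φ b * kap C η w c 1 φ b' * cv w c μ2 b b'
  + ∑ b₁, ∑ b₂, ∑ b₃, ∑ b₄, kap C η w c 1 φ b₁ * kap C η w c 1 φ b₂ * kap C η w c 1 φ b₃ * kap C η w c 1 φ b₄ *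
      (cv w c μ2 b₁ b₂ * cv w c μ2 b₃ b₄ + cv w c μ2 b₁ b₃ * cv w c μ2 b₂ b₄ + cv w c μ2 b₁ b₄ * cv w c μ2 b₂ b₃)

omit m2 in
/-- **`∫dA W_A(A)·D^M_2(0;A,φ) = Z_A·P₂(φ)`** at every scalar field `φ` (with `ct′(0) = 0`: `f₁(0) = h₁(0)`).
[cite: Balaban1983Higgs3, (1.21) p.416, (1.24) p.417] -/
theorem wai_DkM_two (hw : 0 < w) (hμ : 0 < μ2) {cts : ℕ → ℝ → ℝ} (h1 : cts 1 0 = 0) (φ : Cfg P j N) :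
    WAI η w c μ2 (fun A => DkM C η w c cts 2 0 (toVec A) φ) (P2 C η w c μ2 (cts 2 0) φ) := by
  have h := ((wai_sum_sq η c hw hμ (kap C η w c 2 φ)).sub (WAI.const η c hw hμ (1 / 2 * cts 2 0 * massForm w φ))).add
    (wai_sum_mul_sum η c hw hμ (kap C η w c 1 φ) (kap C η w c 1 φ))
  refine h.congr (fun A => ?_) ?_
  · rw [DkM_two, fM_zero, fM_zero, h1]
    simp only [pow_one]
    ring
  · unfold P2
    ring

omit m2 in
/-- **`∫dA W_A(A)·D^M_4(0;A,φ) = Z_A·P₄(φ)`** at every scalar field `φ` (with `ct′(0) = ct‴(0) = 0`).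
[cite: Balaban1983Higgs3, (1.21) p.416, (1.24) p.417] -/
theorem wai_DkM_four (hw : 0 < w) (hμ : 0 < μ2) {cts : ℕ → ℝ → ℝ} (h1 : cts 1 0 = 0) (h3 : cts 3 0 = 0) (φ : Cfg P j N) :
    WAI η w c μ2 (fun A => DkM C η w c cts 4 0 (toVec A) φ) (P4 C η w c μ2 (cts 2 0) (cts 4 0) φ) := by
  have h := ((((((((wai_sum_pow_four η c hw hμ (kap C η w c 4 φ)).sub
      (WAI.const η c hw hμ (1 / 2 * cts 4 0 * massForm w φ))).add
      ((wai_sum_mul_sum_pow_three η c hw hμ (kap C η w c 1 φ) (kap C η w c 3 φ)).const_mul 4)).add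
      ((wai_sum_sq_mul_sum_sq η c hw hμ (kap C η w c 2 φ) (kap C η w c 2 φ)).const_mul 3)).sub
      ((wai_sum_sq η c hw hμ (kap C η w c 2 φ)).const_mul (3 * cts 2 0 * massForm w φ))).add
      (WAI.const η c hw hμ (3 / 4 * cts 2 0 ^ 2 * massForm w φ ^ 2))).add
      ((wai_sum_mul_sum_mul_sum_sq η c hw hμ (kap C η w c 1 φ) (kap C η w c 1 φ) (kap C η w c 2 φ)).const_mul 6)).sub
      ((wai_sum_mul_sum η c hw hμ (kap C η w c 1 φ) (kap C η w c 1 φ)).const_mul (3 * cts 2 0 * massForm w φ))).add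
      (wai_sum_pow_four' η c hw hμ (kap C η w c 1 φ))
  refine h.congr (fun A => ?_) ?_
  · rw [DkM_four]
    simp only [fM_zero, h1, h3, pow_one]
    ring
  · unfold P4
    ring

omit m2 in
/-- `∫dA W_A·D^M_2(0;A,φ) = Z_A·P₂(φ)`. [cite: Balaban1983Higgs3, (1.21) p.416, (1.24) p.417] -/
theorem integral_WA_DkM_two (hw : 0 < w) (hμ : 0 < μ2) {cts : ℕ → ℝ → ℝ} (h1 : cts 1 0 = 0) (φ : Cfg P j N) :
    ∫ A : Cfg P j P.d, WA η w c μ2 A * DkM C η w c cts 2 0 (toVec A) φ =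
      (∫ A : Cfg P j P.d, WA η w c μ2 A) * P2 C η w c μ2 (cts 2 0) φ :=
  (wai_DkM_two C η w c μ2 hw hμ h1 φ).integral_eq

omit m2 in
/-- `∫dA W_A·D^M_4(0;A,φ) = Z_A·P₄(φ)`. [cite: Balaban1983Higgs3, (1.21) p.416, (1.24) p.417] -/
theorem integral_WA_DkM_four (hw : 0 < w) (hμ : 0 < μ2) {cts : ℕ → ℝ → ℝ} (h1 : cts 1 0 = 0) (h3 : cts 3 0 = 0)
    (φ : Cfg P j N) :
    ∫ A : Cfg P j P.d, WA η w c μ2 A * DkM C η w c cts 4 0 (toVec A) φ =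
      (∫ A : Cfg P j P.d, WA η w c μ2 A) * P4 C η w c μ2 (cts 2 0) (cts 4 0) φ :=
  (wai_DkM_four C η w c μ2 hw hμ h1 h3 φ).integral_eq

/-! ## §3 Under `∫dA dφ` at `e = 0`: the joint Gaussian factorizes (`J_0 = W_A·W₀`, BRICK 7 `J_zero`) and the vector field is
integrated out first (Fubini): `∫dA dφ D^M_k(0)e^{−S_0}F = Z_A·∫dφ W₀(φ)P_k(φ)F(φ)` -/

/-- **Fubini at zero charge**: if `∫dA W_A·D^M_k(0;A,φ) = Z_A·P_k(φ)` at every `φ`, then for every scalar observable `F`,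
`∫dA dφ D^M_k(0;A,φ)e^{−S_0(A,φ)}F(φ) = Z_A·∫dφ e^{−½⟨φ,(−Δ^η_0+m²)φ⟩}P_k(φ)F(φ)`. [cite: Balaban1983Higgs3, (1.20)–(1.21) p.416, (1.24) p.417] -/
theorem integral_DkM_J_zero_eq {cts : ℕ → ℝ → ℝ} (k : ℕ) {F Pk : Cfg P j N → ℝ}
    (hint : Integrable (fun p : JCfg P j N => DkM C η w c cts k 0 (toVec p.1) p.2 * J C η w c m2 μ2 0 p * F p.2))
    (hW : ∀ φ, WAI η w c μ2 (fun A => DkM C η w c cts k 0 (toVec A) φ) (Pk φ)) :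
    ∫ p : JCfg P j N, DkM C η w c cts k 0 (toVec p.1) p.2 * J C η w c m2 μ2 0 p * F p.2 =
      (∫ A : Cfg P j P.d, WA η w c μ2 A) *
        ∫ φ : Cfg P j N, weight C η w c m2 (0 : VecField P j ℝ) φ * (Pk φ * F φ) := by
  rw [Measure.volume_eq_prod] at hint
  rw [Measure.volume_eq_prod, integral_prod_symm _ hint]
  have hinner : (fun φ : Cfg P j N => ∫ A : Cfg P j P.d,
      DkM C η w c cts k 0 (toVec A) φ * J C η w c m2 μ2 0 (A, φ) * F φ) =
      fun φ => (∫ A : Cfg P j P.d, WA η w c μ2 A) * (weight C η w c m2 (0 : VecField P j ℝ) φ * (Pk φ * F φ)) := by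
    funext φ
    have e : (fun A : Cfg P j P.d => DkM C η w c cts k 0 (toVec A) φ * J C η w c m2 μ2 0 (A, φ) * F φ) =
        fun A => (WA η w c μ2 A * DkM C η w c cts k 0 (toVec A) φ) * (weight C η w c m2 (0 : VecField P j ℝ) φ * F φ) := by
      funext A
      rw [J_zero]
      ring
    rw [e, integral_mul_const, (hW φ).integral_eq]
    ring
  rw [hinner, integral_const_mul]

/-! ## §4 FROM MOMENTS TO CUMULANTS at a symmetric point: for `Z` positive, even and smooth near `0`,
`(log Z)″(0) = Z″(0)/Z(0)`, `(log Z)⁗(0) = Z⁗(0)/Z(0) − 3(Z″(0)/Z(0))²`, `(log Z)⁽⁶⁾(0) = Z⁽⁶⁾/Z − 15Z″Z⁗/Z² + 30(Z″/Z)³`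
— BRICK 20's Faà di Bruno polynomials `D_k` applied to `Z = e^{log Z}` on an open set (local form), and the vanishing of the odd
derivatives of an even function at `0` -/

section Calculus

open scoped ContDiff

/-- the chain rule through the symbols, LOCAL form: `f_i′ = f_{i+1}` on a set `S` ⇒ `(P(f))′ = (δP)(f)` on `S`.
[cite: GlimmJaffeQP1987, (9.1.3)] -/
theorem hasDerivAt_eval_family_of_mem {f : ℕ → ℝ → ℝ} {S : Set ℝ}
    (hf : ∀ (i : ℕ), ∀ e ∈ S, HasDerivAt (f i) (f (i + 1) e) e) (p : MvPolynomial ℕ ℝ) {e : ℝ} (he : e ∈ S) :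
    HasDerivAt (fun s : ℝ => MvPolynomial.eval (fun i : ℕ => f i s) p)
      (MvPolynomial.eval (fun i : ℕ => f i e) (delta p)) e := by
  induction p using MvPolynomial.induction_on with
  | C a =>
    simp only [eval_C, MvPolynomial.derivation_C, map_zero]
    exact hasDerivAt_const e a
  | add p q hp hq =>
    simp only [map_add]
    exact hp.add hq
  | mul_X p i hp =>
    simp only [map_mul, eval_X, Derivation.leibniz, delta_X, smul_eq_mul, map_add]
    exact (hp.mul (hf i e he)).congr_deriv (by ring)

/-- Faà di Bruno, LOCAL form: `f_i′ = f_{i+1}` and `W′ = f₁W` on `S` ⇒ `(D_k(f)W)′ = D_{k+1}(f)W` on `S`. [cite: GlimmJaffeQP1987, (9.1.3)] -/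
theorem hasDerivAt_Dpoly_mul_family_of_mem {f : ℕ → ℝ → ℝ} {S : Set ℝ}
    (hf : ∀ (i : ℕ), ∀ e ∈ S, HasDerivAt (f i) (f (i + 1) e) e)
    {W : ℝ → ℝ} (hW : ∀ e ∈ S, HasDerivAt W (f 1 e * W e) e) (k : ℕ) {e : ℝ} (he : e ∈ S) :
    HasDerivAt (fun s : ℝ => MvPolynomial.eval (fun i : ℕ => f i s) (Dpoly k) * W s)
      (MvPolynomial.eval (fun i : ℕ => f i e) (Dpoly (k + 1)) * W e) e := by
  have h := (hasDerivAt_eval_family_of_mem hf (Dpoly k) he).mul (hW e he)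
  refine h.congr_deriv ?_
  simp only [Dpoly_succ, map_add, map_mul, eval_X]
  ring

/-- hence `W⁽ᵏ⁾ = D_k(f)·W` ON AN OPEN SET `S` (BRICK 20 `iteratedDeriv_eq_Dpoly_family` was the global form).
[cite: GlimmJaffeQP1987, (9.1.3)] -/
theorem iteratedDeriv_eq_Dpoly_family_of_isOpen {f : ℕ → ℝ → ℝ} {S : Set ℝ} (hS : IsOpen S)
    (hf : ∀ (i : ℕ), ∀ e ∈ S, HasDerivAt (f i) (f (i + 1) e) e)
    {W : ℝ → ℝ} (hW : ∀ e ∈ S, HasDerivAt W (f 1 e * W e) e) (k : ℕ) {e : ℝ} (he : e ∈ S) :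
    iteratedDeriv k W e = MvPolynomial.eval (fun i : ℕ => f i e) (Dpoly k) * W e := by
  induction k generalizing e with
  | zero => simp
  | succ k ih =>
    rw [iteratedDeriv_succ]
    have hev : iteratedDeriv k W =ᶠ[𝓝 e] fun s => MvPolynomial.eval (fun i : ℕ => f i s) (Dpoly k) * W s :=
      Filter.eventually_of_mem (hS.mem_nhds he) fun s hs => ih hs
    rw [hev.deriv_eq]
    exact (hasDerivAt_Dpoly_mul_family_of_mem hf hW k he).deriv

/-- a derivative family `Z_k′ = Z_{k+1}` on an open set computes the iterated derivatives there: `Z⁽ᵏ⁾ = Z_k` on `S`. [folklore] -/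
private theorem iteratedDeriv_eq_of_family {Zk : ℕ → ℝ → ℝ} {S : Set ℝ} (hS : IsOpen S)
    (hZk : ∀ (k : ℕ), ∀ e ∈ S, HasDerivAt (Zk k) (Zk (k + 1) e) e) (k : ℕ) {e : ℝ} (he : e ∈ S) :
    iteratedDeriv k (Zk 0) e = Zk k e := by
  induction k generalizing e with
  | zero => simp
  | succ k ih =>
    rw [iteratedDeriv_succ]
    have hev : iteratedDeriv k (Zk 0) =ᶠ[𝓝 e] Zk k := Filter.eventually_of_mem (hS.mem_nhds he) fun s hs => ih hs
    rw [hev.deriv_eq]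
    exact (hZk k e he).deriv

/-- a derivative family of all orders on an open set makes `Z = Z₀` smooth there. [folklore] -/
private theorem contDiffOn_of_family {Zk : ℕ → ℝ → ℝ} {S : Set ℝ} (hS : IsOpen S)
    (hZk : ∀ (k : ℕ), ∀ e ∈ S, HasDerivAt (Zk k) (Zk (k + 1) e) e) (k : ℕ) : ContDiffOn ℝ ∞ (Zk k) S := by
  have hnat : ∀ n : ℕ, ∀ k : ℕ, ContDiffOn ℝ n (Zk k) S := by
    intro n
    induction n with
    | zero =>
      intro k
      exact contDiffOn_zero.2 fun e he => (hZk k e he).continuousAt.continuousWithinAt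
    | succ n ih =>
      intro k
      rw [Nat.cast_succ, contDiffOn_succ_iff_deriv_of_isOpen hS]
      refine ⟨fun e he => (hZk k e he).differentiableAt.differentiableWithinAt,
        fun h => absurd h (WithTop.natCast_ne_top n), ?_⟩
      exact (ih (k + 1)).congr fun e he => (hZk k e he).deriv
  exact contDiffOn_infty.2 fun n => hnat n k

/-- `D₂(g) = g₂ + g₁²`. [cite: GlimmJaffeQP1987, (9.1.3)] -/
theorem eval_Dpoly_two (g : ℕ → ℝ) : MvPolynomial.eval g (Dpoly 2) = g 2 + g 1 ^ 2 := by
  simp [Dpoly_succ]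
  ring

/-- `D₄(g) = g₄ + 4g₁g₃ + 3g₂² + 6g₁²g₂ + g₁⁴`. [cite: GlimmJaffeQP1987, (9.1.3)] -/
theorem eval_Dpoly_four (g : ℕ → ℝ) : MvPolynomial.eval g (Dpoly 4) =
    g 4 + 4 * (g 1 * g 3) + 3 * g 2 ^ 2 + 6 * (g 1 ^ 2 * g 2) + g 1 ^ 4 := by
  simp [Dpoly_succ, Derivation.leibniz]
  ring

/-- `D₆(g) = g₆ + 6g₁g₅ + 15g₂g₄ + 10g₃² + 15g₁²g₄ + 60g₁g₂g₃ + 15g₂³ + 20g₁³g₃ + 45g₁²g₂² + 15g₁⁴g₂ + g₁⁶` (the complete Bell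
polynomial `B₆`). [cite: GlimmJaffeQP1987, (9.1.3)] -/
theorem eval_Dpoly_six (g : ℕ → ℝ) : MvPolynomial.eval g (Dpoly 6) =
    g 6 + 6 * (g 1 * g 5) + 15 * (g 2 * g 4) + 10 * g 3 ^ 2 + 15 * (g 1 ^ 2 * g 4) + 60 * (g 1 * g 2 * g 3)
      + 15 * g 2 ^ 3 + 20 * (g 1 ^ 3 * g 3) + 45 * (g 1 ^ 2 * g 2 ^ 2) + 15 * (g 1 ^ 4 * g 2) + g 1 ^ 6 := by
  simp [Dpoly_succ, Derivation.leibniz]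
  ring

omit C η w c m2 μ2 in
/-- the derivative of an even function is odd (Mathlib's total `deriv`). [folklore] -/
private theorem deriv_neg_of_even' {f : ℝ → ℝ} (hf : ∀ s, f (-s) = f s) (s : ℝ) : deriv f (-s) = -deriv f s := by
  have h := deriv_comp_neg f s
  have hfe : (fun x => f (-x)) = f := funext hf
  rw [hfe] at h
  linarith

omit C η w c m2 μ2 in
/-- the derivative of an odd function is even. [folklore] -/
private theorem deriv_neg_of_odd' {g : ℝ → ℝ} (hg : ∀ s, g (-s) = -g s) (s : ℝ) : deriv g (-s) = deriv g s := by
  have h := deriv_comp_neg g s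
  have hge : (fun x => g (-x)) = -g := funext hg
  rw [hge, deriv.neg] at h
  linarith

omit C η w c m2 μ2 in
/-- the even-order derivatives of an even function are even. [folklore] -/
private theorem iteratedDeriv_even_of_even' {f : ℝ → ℝ} (hf : ∀ s, f (-s) = f s) (k : ℕ) (s : ℝ) :
    iteratedDeriv (2 * k) f (-s) = iteratedDeriv (2 * k) f s := by
  induction k generalizing s with
  | zero => simpa using hf s
  | succ k ih =>
    have h2 : 2 * (k + 1) = 2 * k + 1 + 1 := by ring
    rw [h2, iteratedDeriv_succ, iteratedDeriv_succ]
    exact deriv_neg_of_odd' (deriv_neg_of_even' ih) s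

omit C η w c m2 μ2 in
/-- the odd-order derivatives of an even function vanish at `0`. [folklore] -/
private theorem iteratedDeriv_odd_eq_zero_of_even' {f : ℝ → ℝ} (hf : ∀ s, f (-s) = f s) (k : ℕ) :
    iteratedDeriv (2 * k + 1) f 0 = 0 := by
  rw [iteratedDeriv_succ]
  have h := deriv_neg_of_even' (iteratedDeriv_even_of_even' hf k) 0
  rw [neg_zero] at h
  linarith

/-- **Faà di Bruno for `Z = e^{log Z}` at a symmetric point**: for `Z` positive and even, with a derivative family of all orders
on an open set `S ∋ 0`, the symbols `ℓ_i = (log Z)⁽ⁱ⁾(0)` satisfy `ℓ₁ = ℓ₃ = ℓ₅ = 0`, `Z″(0) = ℓ₂Z(0)`, `Z⁗(0) = (ℓ₄ + 3ℓ₂²)Z(0)`,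
`Z⁽⁶⁾(0) = (ℓ₆ + 15ℓ₂ℓ₄ + 15ℓ₂³)Z(0)` (moments from cumulants). [cite: GlimmJaffeQP1987, §8.5, (9.1.3)] -/
theorem iteratedDeriv_eq_cumulants_of_even {Z : ℝ → ℝ} {S : Set ℝ} (hS : IsOpen S) (h0 : (0 : ℝ) ∈ S)
    {Zk : ℕ → ℝ → ℝ} (hZ0 : Zk 0 = Z) (hZk : ∀ (k : ℕ), ∀ e ∈ S, HasDerivAt (Zk k) (Zk (k + 1) e) e)
    (hpos : ∀ e ∈ S, 0 < Z e) (heven : ∀ e, Z (-e) = Z e) :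
    iteratedDeriv 1 (fun e => Real.log (Z e)) 0 = 0 ∧ iteratedDeriv 3 (fun e => Real.log (Z e)) 0 = 0 ∧
    iteratedDeriv 5 (fun e => Real.log (Z e)) 0 = 0 ∧
    iteratedDeriv 2 Z 0 = iteratedDeriv 2 (fun e => Real.log (Z e)) 0 * Z 0 ∧
    iteratedDeriv 4 Z 0 = (iteratedDeriv 4 (fun e => Real.log (Z e)) 0
      + 3 * iteratedDeriv 2 (fun e => Real.log (Z e)) 0 ^ 2) * Z 0 ∧
    iteratedDeriv 6 Z 0 = (iteratedDeriv 6 (fun e => Real.log (Z e)) 0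
      + 15 * (iteratedDeriv 2 (fun e => Real.log (Z e)) 0 * iteratedDeriv 4 (fun e => Real.log (Z e)) 0)
      + 15 * iteratedDeriv 2 (fun e => Real.log (Z e)) 0 ^ 3) * Z 0 := by
  subst hZ0
  set L : ℝ → ℝ := fun e => Real.log (Zk 0 e) with hL
  have hZs : ContDiffOn ℝ ∞ (Zk 0) S := contDiffOn_of_family hS hZk 0
  have hLs : ContDiffOn ℝ ∞ L S := hZs.log fun e he => (hpos e he).ne'
  -- the symbols `f_i = (log Z)⁽ⁱ⁾` within `S`
  set f : ℕ → ℝ → ℝ := fun i e => iteratedDerivWithin i L S e with hf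
  have hfd : ∀ (i : ℕ), ∀ e ∈ S, HasDerivAt (f i) (f (i + 1) e) e := by
    intro i e he
    have hdiff : DifferentiableOn ℝ (iteratedDerivWithin i L S) S :=
      hLs.differentiableOn_iteratedDerivWithin (by exact_mod_cast ENat.coe_lt_top i) hS.uniqueDiffOn
    have h1 : HasDerivAt (iteratedDerivWithin i L S) (deriv (iteratedDerivWithin i L S) e) e :=
      ((hdiff e he).differentiableAt (hS.mem_nhds he)).hasDerivAt
    have h2 : f (i + 1) e = deriv (iteratedDerivWithin i L S) e := by
      simp only [hf]
      rw [iteratedDerivWithin_succ, derivWithin_of_isOpen hS he]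
    rw [h2]
    exact h1
  have hW : ∀ e ∈ S, HasDerivAt (Zk 0) (f 1 e * Zk 0 e) e := by
    intro e he
    have hLd : DifferentiableOn ℝ L S := hLs.differentiableOn (by simp)
    have hL1 : HasDerivAt L (deriv L e) e := ((hLd e he).differentiableAt (hS.mem_nhds he)).hasDerivAt
    have hexp : HasDerivAt (fun s => Real.exp (L s)) (Real.exp (L e) * deriv L e) e := hL1.exp
    have hev : (fun s => Real.exp (L s)) =ᶠ[𝓝 e] Zk 0 :=
      Filter.eventually_of_mem (hS.mem_nhds he) fun s hs => Real.exp_log (hpos s hs)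
    have hZ' : HasDerivAt (Zk 0) (Real.exp (L e) * deriv L e) e := hev.hasDerivAt_iff.mp hexp
    refine hZ'.congr_deriv ?_
    simp only [hf]
    rw [iteratedDerivWithin_one, derivWithin_of_isOpen hS he, Real.exp_log (hpos e he)]
    ring
  -- Faà di Bruno at `0`
  have hFdB : ∀ k : ℕ, iteratedDeriv k (Zk 0) 0 = MvPolynomial.eval (fun i : ℕ => f i 0) (Dpoly k) * Zk 0 0 :=
    fun k => iteratedDeriv_eq_Dpoly_family_of_isOpen hS hfd hW k h0
  -- the symbols at `0` are the plain iterated derivatives, and the odd ones vanish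
  have hf0 : ∀ i : ℕ, f i 0 = iteratedDeriv i L 0 := fun i => iteratedDerivWithin_of_isOpen hS h0
  have hLeven : ∀ s, L (-s) = L s := fun s => by simp only [hL, heven]
  have h1 : iteratedDeriv 1 L 0 = 0 := iteratedDeriv_odd_eq_zero_of_even' hLeven 0
  have h3 : iteratedDeriv 3 L 0 = 0 := iteratedDeriv_odd_eq_zero_of_even' hLeven 1
  have h5 : iteratedDeriv 5 L 0 = 0 := iteratedDeriv_odd_eq_zero_of_even' hLeven 2
  have e2 := hFdB 2
  have e4 := hFdB 4
  have e6 := hFdB 6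
  rw [eval_Dpoly_two] at e2
  rw [eval_Dpoly_four] at e4
  rw [eval_Dpoly_six] at e6
  simp only [hf0, h1, h3, h5] at e2 e4 e6
  refine ⟨h1, h3, h5, ?_, ?_, ?_⟩
  · rw [e2]; ring
  · rw [e4]; ring
  · rw [e6]; ring

/-- **`(log Z)″(0) = Z″(0)/Z(0)`, `(log Z)⁗(0) = Z⁗(0)/Z(0) − 3(Z″(0)/Z(0))²`,
`(log Z)⁽⁶⁾(0) = Z⁽⁶⁾(0)/Z(0) − 15Z″(0)Z⁗(0)/Z(0)² + 30(Z″(0)/Z(0))³`** for `Z` positive, even, with a derivative family of all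
orders on an open set `S ∋ 0` — the cumulants of orders 2, 4, 6 of a symmetric weight from its moments.
[cite: GlimmJaffeQP1987, §8.5, (9.1.3)] -/
theorem iteratedDeriv_log_of_even {Z : ℝ → ℝ} {S : Set ℝ} (hS : IsOpen S) (h0 : (0 : ℝ) ∈ S)
    {Zk : ℕ → ℝ → ℝ} (hZ0 : Zk 0 = Z) (hZk : ∀ (k : ℕ), ∀ e ∈ S, HasDerivAt (Zk k) (Zk (k + 1) e) e)
    (hpos : ∀ e ∈ S, 0 < Z e) (heven : ∀ e, Z (-e) = Z e) :
    iteratedDeriv 2 (fun e => Real.log (Z e)) 0 = iteratedDeriv 2 Z 0 / Z 0 ∧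
    iteratedDeriv 4 (fun e => Real.log (Z e)) 0 = iteratedDeriv 4 Z 0 / Z 0 - 3 * (iteratedDeriv 2 Z 0 / Z 0) ^ 2 ∧
    iteratedDeriv 6 (fun e => Real.log (Z e)) 0 = iteratedDeriv 6 Z 0 / Z 0
      - 15 * (iteratedDeriv 2 Z 0 * iteratedDeriv 4 Z 0) / Z 0 ^ 2 + 30 * (iteratedDeriv 2 Z 0 / Z 0) ^ 3 := by
  obtain ⟨-, -, -, e2, e4, e6⟩ := iteratedDeriv_eq_cumulants_of_even hS h0 hZ0 hZk hpos heven
  have hZ : Z 0 ≠ 0 := (hpos 0 h0).ne'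
  refine ⟨?_, ?_, ?_⟩
  · rw [e2]; field_simp
  · rw [e4, e2]; field_simp; ring
  · rw [e6, e4, e2]; field_simp; ring

end Calculus

/-! ## §5 THE INDEX `(4,0)` OF (1.24): `∂⁴/∂e⁴ log∫dA dφ e^{−S^ε_e}∣_{e=0}` along the counterterm curve `m² + δm²(e,0)`, in cumulant
form — raw (`Z⁗(0)/Z(0) − 3(Z″(0)/Z(0))²` with `Z⁽ᵏ⁾(0) = ∫D^M_k(0)e^{−S_0}`), with the vector field integrated out
(`⟨P₄⟩₀ − 3⟨P₂⟩₀²`), for print's polynomial curve `δm²_{(2,0)}e² + δm²_{(4,0)}e⁴`, and for r15's typed series (1.23) at `λ = 0`;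
the raw sixth order `(6,0)` alongside -/

section IndexFourZero

variable {cts : ℕ → ℝ → ℝ} {S : Set ℝ} {Bc : ℝ}

omit C η w c m2 μ2 in
/-- a derivative family is the family of iterated derivatives of its first member. [folklore] -/
private theorem cts_eq_iteratedDeriv (hct : ∀ (i : ℕ) (e : ℝ), HasDerivAt (cts i) (cts (i + 1) e) e) (i : ℕ) :
    cts i = iteratedDeriv i (cts 0) := by
  induction i with
  | zero => simp
  | succ i ih =>
    funext e
    rw [iteratedDeriv_succ, ← ih]
    exact ((hct i e).deriv).symm

omit C η w c m2 μ2 in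
/-- for an even counterterm curve the odd members of its derivative family vanish at `0` (`ct′(0) = ct‴(0) = … = 0`).
[cite: Balaban1983Higgs3, (1.23) p.417] -/
theorem cts_odd_zero (hct : ∀ (i : ℕ) (e : ℝ), HasDerivAt (cts i) (cts (i + 1) e) e)
    (heven : ∀ e, cts 0 (-e) = cts 0 e) (k : ℕ) : cts (2 * k + 1) 0 = 0 := by
  rw [cts_eq_iteratedDeriv hct]
  exact iteratedDeriv_odd_eq_zero_of_even' heven k

/-- **THE INDICES `(2,0)`, `(4,0)`, `(6,0)` OF (1.24) IN RAW CUMULANT FORM.**  For the partition function of (1.24),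
`Z^{ct}(e) = ∫dA dφ e^{−S^ε_e}` with `S^ε_e` = (1.20) at `λ = 0` and the mass counterterm `δm² = ct(e)` inserted (an even curve with a
derivative family `ct_i′ = ct_{i+1}` bounded on an open set `S ∋ 0` where `m² + ct ≥ m²/2` — print's `δm²_{(2,0)}e² + δm²_{(4,0)}e⁴`
on a small ball), writing `Z_k := ∫dA dφ D^M_k(0;A,φ)e^{−S^ε_0}` (`= (Z^{ct})⁽ᵏ⁾(0)`, BRICK 20):
`(log Z^{ct})″(0) = Z₂/Z₀`, **`(log Z^{ct})⁗(0) = Z₄/Z₀ − 3(Z₂/Z₀)²`**, `(log Z^{ct})⁽⁶⁾(0) = Z₆/Z₀ − 15Z₂Z₄/Z₀² + 30(Z₂/Z₀)³` —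
the terms `(α,0)`, `α = 2, 4, 6`, of `E₁` are `(1/α!)e^α` times these (the odd `α` vanish, BRICK 13).
[cite: Balaban1983Higgs3, (1.24) p.417, p.418 ("2 ≤ α + 2β ≤ 6")] [cite: GlimmJaffeQP1987, §8.5] -/
theorem iteratedDeriv_logZ_massCurve_raw (hw : 0 < w) (hm : 0 < m2) (hμ : 0 < μ2)
    (hct : ∀ (i : ℕ) (e : ℝ), HasDerivAt (cts i) (cts (i + 1) e) e) (hS : IsOpen S) (h0S : (0 : ℝ) ∈ S)
    (hBc : ∀ (i : ℕ), ∀ e ∈ S, |cts i e| ≤ Bc) (hmass : ∀ e ∈ S, m2 / 2 ≤ m2 + cts 0 e)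
    (heven : ∀ e, cts 0 (-e) = cts 0 e) :
    iteratedDeriv 2 (fun e => Real.log (∫ p : JCfg P j N, J C η w c (m2 + cts 0 e) μ2 e p)) 0 =
      (∫ p : JCfg P j N, DkM C η w c cts 2 0 (toVec p.1) p.2 * J C η w c (m2 + cts 0 0) μ2 0 p) /
        (∫ p : JCfg P j N, J C η w c (m2 + cts 0 0) μ2 0 p) ∧
    iteratedDeriv 4 (fun e => Real.log (∫ p : JCfg P j N, J C η w c (m2 + cts 0 e) μ2 e p)) 0 =
      (∫ p : JCfg P j N, DkM C η w c cts 4 0 (toVec p.1) p.2 * J C η w c (m2 + cts 0 0) μ2 0 p) /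
        (∫ p : JCfg P j N, J C η w c (m2 + cts 0 0) μ2 0 p)
      - 3 * ((∫ p : JCfg P j N, DkM C η w c cts 2 0 (toVec p.1) p.2 * J C η w c (m2 + cts 0 0) μ2 0 p) /
        (∫ p : JCfg P j N, J C η w c (m2 + cts 0 0) μ2 0 p)) ^ 2 ∧
    iteratedDeriv 6 (fun e => Real.log (∫ p : JCfg P j N, J C η w c (m2 + cts 0 e) μ2 e p)) 0 =
      (∫ p : JCfg P j N, DkM C η w c cts 6 0 (toVec p.1) p.2 * J C η w c (m2 + cts 0 0) μ2 0 p) /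
        (∫ p : JCfg P j N, J C η w c (m2 + cts 0 0) μ2 0 p)
      - 15 * ((∫ p : JCfg P j N, DkM C η w c cts 2 0 (toVec p.1) p.2 * J C η w c (m2 + cts 0 0) μ2 0 p) *
          (∫ p : JCfg P j N, DkM C η w c cts 4 0 (toVec p.1) p.2 * J C η w c (m2 + cts 0 0) μ2 0 p)) /
        (∫ p : JCfg P j N, J C η w c (m2 + cts 0 0) μ2 0 p) ^ 2
      + 30 * ((∫ p : JCfg P j N, DkM C η w c cts 2 0 (toVec p.1) p.2 * J C η w c (m2 + cts 0 0) μ2 0 p) /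
        (∫ p : JCfg P j N, J C η w c (m2 + cts 0 0) μ2 0 p)) ^ 3 := by
  -- the derivative family `Z_k(e) = ∫D^M_k(e)e^{−S_e}` of BRICK 20 §8 (observable `F = 1`)
  set Zk : ℕ → ℝ → ℝ := fun k e =>
    ∫ p : JCfg P j N, DkM C η w c cts k e (toVec p.1) p.2 * J C η w c (m2 + cts 0 e) μ2 e p with hZk_def
  have hZk : ∀ (k : ℕ), ∀ e ∈ S, HasDerivAt (Zk k) (Zk (k + 1) e) e := by
    intro k e he
    have h := hasDerivAt_integral_DkM_J_mul C η w c m2 μ2 hw hm hμ hct hS hBc hmass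
      (ExpGrowth.const (P := P) (j := j) (N := N) (1 : ℝ)) k he
    simp only [mul_one] at h
    exact h
  have hZ0 : Zk 0 = fun e => ∫ p : JCfg P j N, J C η w c (m2 + cts 0 e) μ2 e p := by
    funext e
    exact integral_congr_ae (Filter.Eventually.of_forall fun p => by simp [DkM])
  have hpos : ∀ e ∈ S, 0 < ∫ p : JCfg P j N, J C η w c (m2 + cts 0 e) μ2 e p := fun e he =>
    integral_J_pos C η w c (m2 + cts 0 e) μ2 hw (by linarith [hmass e he]) hμ e
  have hev : ∀ e : ℝ, (∫ p : JCfg P j N, J C η w c (m2 + cts 0 (-e)) μ2 (-e) p) =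
      ∫ p : JCfg P j N, J C η w c (m2 + cts 0 e) μ2 e p := fun e =>
    B3Eq124VacuumChargeWick.Z_curve_neg_charge C η w c m2 μ2 heven e
  obtain ⟨e2, e4, e6⟩ := iteratedDeriv_log_of_even hS h0S hZ0 hZk hpos hev
  have hD : ∀ k : ℕ, iteratedDeriv k (fun e => ∫ p : JCfg P j N, J C η w c (m2 + cts 0 e) μ2 e p) 0 = Zk k 0 := by
    intro k
    rw [← hZ0]
    exact iteratedDeriv_eq_of_family hS hZk k h0S
  rw [hD 2] at e2 e4 e6
  rw [hD 4] at e4 e6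
  rw [hD 6] at e6
  exact ⟨e2, e4, e6⟩

/-- **THE INDEX `(4,0)` OF (1.24) WITH THE VECTOR FIELD INTEGRATED OUT** (and `(2,0)` alongside): with `ct(0) = 0`,
`∂²/∂e² log Z^{ct}∣₀ = ⟨P₂⟩₀` and **`∂⁴/∂e⁴ log Z^{ct}∣₀ = ⟨P₄⟩₀ − 3⟨P₂⟩₀²`**, `⟨·⟩₀` the normalized expectation of the free
scalar field `e^{−½⟨φ,(−Δ^η_0+m²)φ⟩}dφ` and `P₂`, `P₄` the explicit polynomials of §2 (`ct″(0)`, `ct⁗(0)` entering as the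
mass-counterterm vertices) — the order-`e⁴` vacuum term of `E₁` is `(e⁴/4!)·` this; what remains for print's *"connected graphs without
external legs"* is the scalar Wick theorem on `⟨P₄⟩₀`, `⟨P₂⟩₀` (BRICK 13 did it for `⟨P₂⟩₀`: figure-eight + theta − bubble).
[cite: Balaban1983Higgs3, (1.24) p.417, p.418] [cite: GlimmJaffeQP1987, §8.5] -/
theorem iteratedDeriv_four_logZ_massCurve (hw : 0 < w) (hm : 0 < m2) (hμ : 0 < μ2)
    (hct : ∀ (i : ℕ) (e : ℝ), HasDerivAt (cts i) (cts (i + 1) e) e) (hS : IsOpen S) (h0S : (0 : ℝ) ∈ S)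
    (hBc : ∀ (i : ℕ), ∀ e ∈ S, |cts i e| ≤ Bc) (hmass : ∀ e ∈ S, m2 / 2 ≤ m2 + cts 0 e)
    (heven : ∀ e, cts 0 (-e) = cts 0 e) (h00 : cts 0 0 = 0) :
    iteratedDeriv 2 (fun e => Real.log (∫ p : JCfg P j N, J C η w c (m2 + cts 0 e) μ2 e p)) 0 =
      (∫ φ : Cfg P j N, weight C η w c m2 (0 : VecField P j ℝ) φ * P2 C η w c μ2 (cts 2 0) φ) /
        (∫ φ : Cfg P j N, weight C η w c m2 (0 : VecField P j ℝ) φ) ∧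
    iteratedDeriv 4 (fun e => Real.log (∫ p : JCfg P j N, J C η w c (m2 + cts 0 e) μ2 e p)) 0 =
      (∫ φ : Cfg P j N, weight C η w c m2 (0 : VecField P j ℝ) φ * P4 C η w c μ2 (cts 2 0) (cts 4 0) φ) /
        (∫ φ : Cfg P j N, weight C η w c m2 (0 : VecField P j ℝ) φ)
      - 3 * ((∫ φ : Cfg P j N, weight C η w c m2 (0 : VecField P j ℝ) φ * P2 C η w c μ2 (cts 2 0) φ) /
        (∫ φ : Cfg P j N, weight C η w c m2 (0 : VecField P j ℝ) φ)) ^ 2 := by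
  obtain ⟨e2, e4, -⟩ := iteratedDeriv_logZ_massCurve_raw C η w c m2 μ2 hw hm hμ hct hS h0S hBc hmass heven
  have h1 : cts 1 0 = 0 := cts_odd_zero hct heven 0
  have h3 : cts 3 0 = 0 := cts_odd_zero hct heven 1
  -- the two numerators with `A` integrated out (§2–§3), observable `F = 1`
  have hi2 := integrable_DkM_J_mul C η w c m2 μ2 hw hm hμ hBc hmass (ExpGrowth.const (P := P) (j := j) (N := N) (1 : ℝ)) 2 h0S
  have hi4 := integrable_DkM_J_mul C η w c m2 μ2 hw hm hμ hBc hmass (ExpGrowth.const (P := P) (j := j) (N := N) (1 : ℝ)) 4 h0S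
  rw [h00, add_zero] at hi2 hi4
  have n2 := integral_DkM_J_zero_eq C η w c m2 μ2 2 (F := fun _ => (1 : ℝ)) hi2 (wai_DkM_two C η w c μ2 hw hμ h1)
  have n4 := integral_DkM_J_zero_eq C η w c m2 μ2 4 (F := fun _ => (1 : ℝ)) hi4 (wai_DkM_four C η w c μ2 hw hμ h1 h3)
  simp only [mul_one] at n2 n4
  rw [h00, add_zero] at e2 e4
  rw [n2, B3Eq124VacuumChargeWick.integral_J_zero_eq C η w c m2 μ2 0 rfl] at e2
  rw [n2, n4, B3Eq124VacuumChargeWick.integral_J_zero_eq C η w c m2 μ2 0 rfl] at e4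
  have hZA : (∫ A : Cfg P j P.d, WA η w c μ2 A) ≠ 0 := (ZA_pos η w c μ2 hw hμ).ne'
  rw [mul_div_mul_left _ _ hZA] at e2
  rw [mul_div_mul_left _ _ hZA, mul_div_mul_left _ _ hZA] at e4
  exact ⟨e2, e4⟩

/-! ### print's curve `δm²∣_{λ=0} = δm²_{(2,0)}e² + δm²_{(4,0)}e⁴` and its derivative family -/

/-- the derivative family of the quartic even polynomial `δ₂e² + δ₄e⁴` (`ct, ct′, ct″, ct‴, ct⁗, 0, 0, …`).
[cite: Balaban1983Higgs3, (1.23) p.417] -/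
def polyCts (δ₂ δ₄ : ℝ) : ℕ → ℝ → ℝ
  | 0 => fun e => δ₂ * e ^ 2 + δ₄ * e ^ 4
  | 1 => fun e => 2 * δ₂ * e + 4 * δ₄ * e ^ 3
  | 2 => fun e => 2 * δ₂ + 12 * δ₄ * e ^ 2
  | 3 => fun e => 24 * δ₄ * e
  | 4 => fun _ => 24 * δ₄
  | _ + 5 => fun _ => 0

omit C η w c m2 μ2 in
/-- `polyCts_i′ = polyCts_{i+1}`. [cite: Balaban1983Higgs3, (1.23) p.417] -/
theorem hasDerivAt_polyCts (δ₂ δ₄ : ℝ) (i : ℕ) (e : ℝ) :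
    HasDerivAt (polyCts δ₂ δ₄ i) (polyCts δ₂ δ₄ (i + 1) e) e := by
  match i with
  | 0 =>
    show HasDerivAt (fun x : ℝ => δ₂ * x ^ 2 + δ₄ * x ^ 4) (2 * δ₂ * e + 4 * δ₄ * e ^ 3) e
    refine (((hasDerivAt_pow 2 e).const_mul δ₂).add ((hasDerivAt_pow 4 e).const_mul δ₄)).congr_deriv ?_
    push_cast
    ring
  | 1 =>
    show HasDerivAt (fun x : ℝ => 2 * δ₂ * x + 4 * δ₄ * x ^ 3) (2 * δ₂ + 12 * δ₄ * e ^ 2) e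
    refine (((hasDerivAt_id' e).const_mul (2 * δ₂)).add ((hasDerivAt_pow 3 e).const_mul (4 * δ₄))).congr_deriv ?_
    push_cast
    ring
  | 2 =>
    show HasDerivAt (fun x : ℝ => 2 * δ₂ + 12 * δ₄ * x ^ 2) (24 * δ₄ * e) e
    refine ((hasDerivAt_const e (2 * δ₂)).add ((hasDerivAt_pow 2 e).const_mul (12 * δ₄))).congr_deriv ?_
    push_cast
    ring
  | 3 =>
    show HasDerivAt (fun x : ℝ => 24 * δ₄ * x) (24 * δ₄) e
    exact ((hasDerivAt_id' e).const_mul (24 * δ₄)).congr_deriv (mul_one _)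
  | 4 =>
    show HasDerivAt (fun _ : ℝ => 24 * δ₄) 0 e
    exact hasDerivAt_const e _
  | n + 5 =>
    show HasDerivAt (fun _ : ℝ => (0 : ℝ)) 0 e
    exact hasDerivAt_const e _

omit C η w c m2 μ2 in
/-- on the unit ball every member of the family is bounded by `24(∣δ₂∣ + ∣δ₄∣)`. [cite: Balaban1983Higgs3, (1.23) p.417] -/
theorem abs_polyCts_le (δ₂ δ₄ : ℝ) (i : ℕ) {e : ℝ} (he : |e| ≤ 1) :
    |polyCts δ₂ δ₄ i e| ≤ 24 * (|δ₂| + |δ₄|) := by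
  have h2 : |δ₂| * |e| ^ 2 ≤ |δ₂| := by
    have := pow_le_one₀ (abs_nonneg e) he (n := 2); nlinarith [abs_nonneg δ₂]
  have h4 : |δ₄| * |e| ^ 4 ≤ |δ₄| := by
    have := pow_le_one₀ (abs_nonneg e) he (n := 4); nlinarith [abs_nonneg δ₄]
  have h3 : |δ₄| * |e| ^ 3 ≤ |δ₄| := by
    have := pow_le_one₀ (abs_nonneg e) he (n := 3); nlinarith [abs_nonneg δ₄]
  have h1 : |δ₂| * |e| ≤ |δ₂| := by nlinarith [abs_nonneg δ₂, abs_nonneg e]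
  have h1' : |δ₄| * |e| ≤ |δ₄| := by nlinarith [abs_nonneg δ₄, abs_nonneg e]
  have hδ₂ := abs_nonneg δ₂
  have hδ₄ := abs_nonneg δ₄
  match i with
  | 0 =>
    show |δ₂ * e ^ 2 + δ₄ * e ^ 4| ≤ 24 * (|δ₂| + |δ₄|)
    calc |δ₂ * e ^ 2 + δ₄ * e ^ 4| ≤ |δ₂ * e ^ 2| + |δ₄ * e ^ 4| := abs_add_le _ _
      _ = |δ₂| * |e| ^ 2 + |δ₄| * |e| ^ 4 := by rw [abs_mul, abs_mul, abs_pow, abs_pow]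
      _ ≤ 24 * (|δ₂| + |δ₄|) := by linarith
  | 1 =>
    show |2 * δ₂ * e + 4 * δ₄ * e ^ 3| ≤ 24 * (|δ₂| + |δ₄|)
    calc |2 * δ₂ * e + 4 * δ₄ * e ^ 3| ≤ |2 * δ₂ * e| + |4 * δ₄ * e ^ 3| := abs_add_le _ _
      _ = 2 * (|δ₂| * |e|) + 4 * (|δ₄| * |e| ^ 3) := by
          rw [abs_mul, abs_mul, abs_mul, abs_mul, abs_pow, abs_two, show |(4 : ℝ)| = 4 by norm_num]; ring
      _ ≤ 24 * (|δ₂| + |δ₄|) := by linarith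
  | 2 =>
    show |2 * δ₂ + 12 * δ₄ * e ^ 2| ≤ 24 * (|δ₂| + |δ₄|)
    have h2' : |δ₄| * |e| ^ 2 ≤ |δ₄| := by
      have := pow_le_one₀ (abs_nonneg e) he (n := 2); nlinarith [abs_nonneg δ₄]
    calc |2 * δ₂ + 12 * δ₄ * e ^ 2| ≤ |2 * δ₂| + |12 * δ₄ * e ^ 2| := abs_add_le _ _
      _ = 2 * |δ₂| + 12 * (|δ₄| * |e| ^ 2) := by
          rw [abs_mul, abs_mul, abs_mul, abs_pow, abs_two, show |(12 : ℝ)| = 12 by norm_num]; ring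
      _ ≤ 24 * (|δ₂| + |δ₄|) := by linarith
  | 3 =>
    show |24 * δ₄ * e| ≤ 24 * (|δ₂| + |δ₄|)
    rw [abs_mul, abs_mul, show |(24 : ℝ)| = 24 by norm_num]
    linarith
  | 4 =>
    show |24 * δ₄| ≤ 24 * (|δ₂| + |δ₄|)
    rw [abs_mul, show |(24 : ℝ)| = 24 by norm_num]
    linarith
  | n + 5 =>
    show |(0 : ℝ)| ≤ 24 * (|δ₂| + |δ₄|)
    rw [abs_zero]
    positivity

omit C η w c μ2 in
/-- a ball at `0` inside the unit ball on which `m² + δ₂e² + δ₄e⁴ ≥ m²/2`. [cite: Balaban1983Higgs3, (1.23) p.417] -/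
theorem exists_ball_polyCts (hm : 0 < m2) (δ₂ δ₄ : ℝ) : ∃ r : ℝ, 0 < r ∧ r ≤ 1 ∧
    ∀ e ∈ Metric.ball (0 : ℝ) r, m2 / 2 ≤ m2 + polyCts δ₂ δ₄ 0 e := by
  have hc : Continuous (polyCts δ₂ δ₄ 0) := by
    show Continuous fun e : ℝ => δ₂ * e ^ 2 + δ₄ * e ^ 4
    fun_prop
  have h0 : polyCts δ₂ δ₄ 0 0 = 0 := by
    show δ₂ * (0 : ℝ) ^ 2 + δ₄ * (0 : ℝ) ^ 4 = 0
    norm_num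
  obtain ⟨r₀, hr₀, hr⟩ := Metric.continuousAt_iff.mp hc.continuousAt (m2 / 2) (half_pos hm)
  refine ⟨min r₀ 1, lt_min hr₀ one_pos, min_le_right _ _, fun e he => ?_⟩
  have he' : dist e 0 < r₀ := lt_of_lt_of_le (Metric.mem_ball.mp he) (min_le_left _ _)
  have h := hr he'
  rw [h0, Real.dist_eq, sub_zero] at h
  have := neg_abs_le (polyCts δ₂ δ₄ 0 e)
  linarith

/-- **THE INDEX `(4,0)` OF (1.24) FOR PRINT'S COUNTERTERM CURVE `δm² = δm²_{(2,0)}e² + δm²_{(4,0)}e⁴`** (the series (1.23) at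
`λ = 0`, `δm²_{(3,0)} = 0`): **`∂⁴/∂e⁴∣₀ log∫dA dφ e^{−S^ε_e} = ⟨P₄⟩₀ − 3⟨P₂⟩₀²`** with the mass-counterterm vertices
`ct″(0) = 2δm²_{(2,0)}`, `ct⁗(0) = 24δm²_{(4,0)}` — ONLY `δm²_{(2,0)}` and `δm²_{(4,0)}` enter the order-`e⁴` vacuum term, the latter
linearly through the bubble `−12δm²_{(4,0)}·⟨Σ_xη^d∣φ(x)∣²⟩₀`; and `∂²/∂e²∣₀ log Z = ⟨P₂⟩₀` (= BRICK 13's value before its scalar Wick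
theorem). Hypotheses: `η^d > 0`, `m², μ₀² > 0` only. [cite: Balaban1983Higgs3, (1.23)–(1.24) p.417, p.418] -/
theorem iteratedDeriv_four_logZ_poly (hw : 0 < w) (hm : 0 < m2) (hμ : 0 < μ2) (δ₂ δ₄ : ℝ) :
    iteratedDeriv 2 (fun e => Real.log (∫ p : JCfg P j N, J C η w c (m2 + (δ₂ * e ^ 2 + δ₄ * e ^ 4)) μ2 e p)) 0 =
      (∫ φ : Cfg P j N, weight C η w c m2 (0 : VecField P j ℝ) φ * P2 C η w c μ2 (2 * δ₂) φ) /
        (∫ φ : Cfg P j N, weight C η w c m2 (0 : VecField P j ℝ) φ) ∧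
    iteratedDeriv 4 (fun e => Real.log (∫ p : JCfg P j N, J C η w c (m2 + (δ₂ * e ^ 2 + δ₄ * e ^ 4)) μ2 e p)) 0 =
      (∫ φ : Cfg P j N, weight C η w c m2 (0 : VecField P j ℝ) φ * P4 C η w c μ2 (2 * δ₂) (24 * δ₄) φ) /
        (∫ φ : Cfg P j N, weight C η w c m2 (0 : VecField P j ℝ) φ)
      - 3 * ((∫ φ : Cfg P j N, weight C η w c m2 (0 : VecField P j ℝ) φ * P2 C η w c μ2 (2 * δ₂) φ) /
        (∫ φ : Cfg P j N, weight C η w c m2 (0 : VecField P j ℝ) φ)) ^ 2 := by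
  obtain ⟨r, hr, hr1, hmass⟩ := exists_ball_polyCts m2 hm δ₂ δ₄
  have hBc : ∀ (i : ℕ), ∀ e ∈ Metric.ball (0 : ℝ) r, |polyCts δ₂ δ₄ i e| ≤ 24 * (|δ₂| + |δ₄|) := fun i e he =>
    abs_polyCts_le δ₂ δ₄ i (by
      have h := Metric.mem_ball.mp he
      rw [Real.dist_eq, sub_zero] at h
      linarith)
  have h := iteratedDeriv_four_logZ_massCurve (P := P) (j := j) C η w c m2 μ2 hw hm hμ (hasDerivAt_polyCts δ₂ δ₄)
    Metric.isOpen_ball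
    (Metric.mem_ball_self hr) hBc hmass (fun e => by show δ₂ * (-e) ^ 2 + δ₄ * (-e) ^ 4 = δ₂ * e ^ 2 + δ₄ * e ^ 4; ring)
    (by show δ₂ * (0 : ℝ) ^ 2 + δ₄ * (0 : ℝ) ^ 4 = 0; norm_num)
  have e2 : polyCts δ₂ δ₄ 2 0 = 2 * δ₂ := by show 2 * δ₂ + 12 * δ₄ * (0 : ℝ) ^ 2 = 2 * δ₂; norm_num
  have e4 : polyCts δ₂ δ₄ 4 0 = 24 * δ₄ := rfl
  rw [e2, e4] at h
  exact h

omit C η w c m2 μ2 in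
/-- r15's typed series (1.23) at `λ = 0` is the polynomial `δm²_{(2,0)}e² + δm²_{(3,0)}e³ + δm²_{(4,0)}e⁴` (BRICK 13's private lemma,
re-derived). [cite: Balaban1983Higgs3, (1.23) p.417] -/
private theorem dm2Of123_at_lam_zero' {X : Type*} [Fintype X] (e epsd : ℝ) (Sg : ℕ → ℕ → X → ℝ) :
    B3Sect1TwoPoint.dm2Of123 e 0 epsd Sg =
      B3Sect1TwoPoint.dm2Coeff epsd Sg 2 0 * e ^ 2 + B3Sect1TwoPoint.dm2Coeff epsd Sg 3 0 * e ^ 3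
        + B3Sect1TwoPoint.dm2Coeff epsd Sg 4 0 * e ^ 4 := by
  simp [B3Sect1TwoPoint.dm2Of123, B3Sect1TwoPoint.idx123_eq]
  ring

/-- **THE INDEX `(4,0)` OF (1.24) WITH r15's TYPED SERIES (1.23) INSERTED AT `λ = 0`** (`B3Sect1TwoPoint.dm2Of123 e 0 ε^d Σ^ε`, any
coefficients with `δm²_{(3,0)} = 0` as (1.23) has it): `∂⁴/∂e⁴∣₀ log Z^ε = ⟨P₄⟩₀ − 3⟨P₂⟩₀²` at `ct″(0) = 2δm²_{(2,0)}`,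
`ct⁗(0) = 24δm²_{(4,0)}`. [cite: Balaban1983Higgs3, (1.23)–(1.24) p.417, p.418] -/
theorem iteratedDeriv_four_logZ_dm2Of123 (hw : 0 < w) (hm : 0 < m2) (hμ : 0 < μ2) {X : Type*} [Fintype X] (epsd : ℝ)
    (Sg : ℕ → ℕ → X → ℝ) (h30 : B3Sect1TwoPoint.dm2Coeff epsd Sg 3 0 = 0) :
    iteratedDeriv 4 (fun e => Real.log (∫ p : JCfg P j N,
      J C η w c (m2 + B3Sect1TwoPoint.dm2Of123 e 0 epsd Sg) μ2 e p)) 0 =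
      (∫ φ : Cfg P j N, weight C η w c m2 (0 : VecField P j ℝ) φ *
          P4 C η w c μ2 (2 * B3Sect1TwoPoint.dm2Coeff epsd Sg 2 0) (24 * B3Sect1TwoPoint.dm2Coeff epsd Sg 4 0) φ) /
        (∫ φ : Cfg P j N, weight C η w c m2 (0 : VecField P j ℝ) φ)
      - 3 * ((∫ φ : Cfg P j N, weight C η w c m2 (0 : VecField P j ℝ) φ *
          P2 C η w c μ2 (2 * B3Sect1TwoPoint.dm2Coeff epsd Sg 2 0) φ) /
        (∫ φ : Cfg P j N, weight C η w c m2 (0 : VecField P j ℝ) φ)) ^ 2 := by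
  have hfun : (fun e => Real.log (∫ p : JCfg P j N, J C η w c (m2 + B3Sect1TwoPoint.dm2Of123 e 0 epsd Sg) μ2 e p)) =
      fun e => Real.log (∫ p : JCfg P j N, J C η w c (m2 + (B3Sect1TwoPoint.dm2Coeff epsd Sg 2 0 * e ^ 2
        + B3Sect1TwoPoint.dm2Coeff epsd Sg 4 0 * e ^ 4)) μ2 e p) := by
    funext e
    rw [dm2Of123_at_lam_zero', h30]
    simp
  rw [hfun]
  exact (iteratedDeriv_four_logZ_poly C η w c m2 μ2 hw hm hμ _ _).2

end IndexFourZero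


end Literature.MathematicalPhysics.QuantumFieldTheory.Balaban1983to89.B3Eq124IndexFourZero

end
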